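import Literature.Probability.LatticeModels.BoxSineHarmonic
import Literature.Probability.Percolation.PlanarDuality
import Mathlib.Analysis.SpecialFunctions.Pow.Real
import HarnessLib

/-!
# The weak discrete Beurling estimate on `ℤ²` (Kesten 1987; Smirnov 2010, Appendix B, Lemma B.2)

Topic `Literature/Probability/LatticeModels`; a fully proved instalment of the discrete harmonic
toolkit behind crit-ising.S18 / Smirnov's Theorem 2.2 (node 5 of `Sweep1Proofs.lean`, module
docstring §2; item P5, "the weak Beurling estimate", of the road of §2b, consumed by step B3 there:
boundary values of the discrete primitive `H` near a rough boundary point). S. Smirnov,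
*Conformal invariance in random cluster models. I*, Ann. of Math. 172 (2010), Appendix B,
Lemma B.2 ("Lemma 7.2" of the arXiv text rendering, arXiv:0708.0039):

> There exists an increasing positive function `ε` on `ℝ₊` with `lim_{x→0+} ε(x) = 0`, such that
> the following holds. Let `H` be a non-negative bounded discrete harmonic function in a simply
> connected domain `Ω` with boundary values equal to zero on `Ω ∩ B(z, r)` and at most one
> elsewhere. If `dist(z, ∂Ω) < δ`, then `H(z) < ε(δ/r)`. This is a weaker version of discrete
> Beurling's estimate `ε(δ/r) = const √(δ/r)`. It can be reformulated in terms of the hitting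
> probabilities for the simple random walk and is found in Kesten's [Kes87].

(H. Kesten, *Hitting probabilities of random walks on `ℤ^d`*, Stoch. Proc. Appl. 25 (1987);
G. Lawler, V. Limic, *Random Walk: A Modern Introduction* (2010), §6.) We prove it on `ℤ²`
(mesh `1`; the statement is scale invariant) with the power law `ε(t) = C t^β`, `β > 0`
universal, in the following lattice form (`weakBeurling_of_cutPath`, packaged with existential
constants as `weakBeurling`): `S ⊆ ℤ²` finite (the lattice domain), `h` lattice harmonic on `S`
(`IsLatticeHarmonicOn`, `LatticeLaplacian.lean`), `h ≤ 1` on the outer vertex boundary `∂S` and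
`h = 0` on `∂S ∩ sqBox p R`, `p` a site joined to the outside of the box `sqBox p R` (sup-radius
`R`) by a nearest-neighbour path avoiding `S` — the lattice counterpart of "`Ω` simply connected
and `p ∈ ∂Ω`": the complement of `Ω` is connected to infinity —; then
`h(z) ≤ C ((ρ+1)/(R+1))^β` for `z ∈ S ∩ sqBox p ρ`. The variant `weakBeurling_of_noCircuit`
assumes instead that no closed lattice walk in `S ∩ sqBox p R` winds around `p`, which is what an
exterior path on any finer lattice yields (`WeakBeurling.walkWinding_closed_eq_of_walk`). No sign
condition on `h` is needed for the upper bound.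

## The proof (all of it in this file; no random walks are used)

* §1–§2 (planar topology, after `Percolation/PlanarDuality.lean`): the winding number of a
  *closed* lattice walk is constant along any walk avoiding it (`walkWinding_closed_eq_of_walk`),
  vanishes outside its box, and telescopes for walks right of the base point; an exit-prefix lemma
  for walks. If `S` contained long crossings of all four strips of the square annulus
  `sqBox p (4n) ∖ sqBox p n`, consecutive ones would meet in the corner squares (the crossing
  lemma `Percolation.exists_mem_support_of_crossing`) and splice into a closed walk in `S` of
  winding `-1` about `p` (`exists_circuit_of_longCrossings`), which the cut from `p` would have
  to cross: so at every scale one strip is **blocked** (`not_all_longCrossings_of_cut`).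
* §3 (the barrier): the first sine mode `sin(πX/(L+1)) φ₁(Y)/φ₁(M+1)` of a lattice rectangle
  (`BoxSineHarmonic.lean`: `dstSin`, `dstProfile` and their recurrences and bounds) is lattice
  harmonic, vanishes on three sides, is `≤ 1`, and is `≥ c_b = (2/5) e^{-4π}` on the zone
  `X/(L+1) ∈ [1/4, 3/4]`, `Y ≥ (L+1)/5` when `M + 1 ≤ 4 (L + 1)` (`φ₁(Y) ≥ Y φ₁(1) ≥ 4Y/(L+1)`,
  `φ₁(M+1) ≤ e^{4π}`). **Barrier step** (`barrier_step`, any of the eight frames): a function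
  superharmonic on `D ⊆` rectangle, `≥ 0` on `∂D` and `≥ γ` at the points of `∂D` inside the
  rectangle or on its far side is `≥ γ c_b` on the zone (comparison principle
  `le_of_sub_super_of_boundary`).
* §4 (one scale): the escape function `ψ` of the scale — harmonic on `S ∩ sqBox p (4n)`, `1` off
  `S`, `0` on `S` outside the box (`exists_isLatticeHarmonicOn_eq_off`) — dominates `h`:
  `h ≤ M₀ (1 - ψ)` if `h ≤ M₀` on `S ∩ sqBox p (4n+1)`. In the blocked strip `U`, the
  `S ∩ U`-component of a point of the middle zone misses one short side of `U`; its outer boundary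
  inside the closed strip lies off `S`, where `ψ = 1`, so the barrier step toward the missed side
  gives `ψ ≥ c_b` on the middle zone, and a second barrier step on an approach rectangle from
  `sqBox p n` to that zone gives `ψ ≥ c_b²` on `S ∩ sqBox p n`.
* §5–§6: hence `sup_{S ∩ sqBox p n} h ≤ (1 - c_b²) sup_{S ∩ sqBox p (4n+1)} h`; iterating over
  the radii `r₀ = ρ + 1`, `r_{j+1} = 4 r_j + 1 ≤ R` gives `θ^j`, `θ = 1 - c_b²`, i.e.
  `C ((ρ+1)/(R+1))^β` with `β = log(1/θ)/log 4`, `C = 4^β/θ`.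

Everything here is proved; the constants are explicit but not optimised (Kesten's exponent is
`1/2`). Written by the literature-prover seat of the FK-Ising/SLE(16/3) cone as the input P5 of the
S18 road; the consumer rescales `δℤ²` (and the face lattice shifted by `(½, ½)δ`) to `Site 2`.

## References

* S. Smirnov, *Conformal invariance in random cluster models. I. Holomorphic fermions in the Ising
  model*, Ann. of Math. 172 (2010) 1435–1467, Appendix B, Lemmas B.2–B.3 [Smirnov2010].
* H. Kesten, *Hitting probabilities of random walks on `ℤ^d`*, Stoch. Proc. Appl. 25 (1987)
  165–184 [Kesten1987].
* H. Kesten, *Percolation theory for mathematicians*, Birkhäuser (1982), §2.2 (crossing and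
  circuit arguments) [Kesten1982].
* G. F. Lawler, V. Limic, *Random Walk: A Modern Introduction*, CUP (2010), §6.1, §8.1
  [LawlerLimic2010].
-/

noncomputable section

namespace Literature.Probability.LatticeModels

open Finset Real SimpleGraph
open Literature.Probability.Percolation

namespace WeakBeurling

/-! ### §0. Coordinates, boxes, adjacency and the outer boundary -/

/-- Coordinates of the four unit vectors `cornerUnit k` (east, north, west, south). [folklore] -/
theorem add_cornerUnit_apply (v : Site 2) :
    ((v + cornerUnit 0) 0 = v 0 + 1 ∧ (v + cornerUnit 0) 1 = v 1) ∧
    ((v + cornerUnit 1) 0 = v 0 ∧ (v + cornerUnit 1) 1 = v 1 + 1) ∧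
    ((v + cornerUnit 2) 0 = v 0 - 1 ∧ (v + cornerUnit 2) 1 = v 1) ∧
    ((v + cornerUnit 3) 0 = v 0 ∧ (v + cornerUnit 3) 1 = v 1 - 1) := by
  refine ⟨by simp [cornerUnit], by simp [cornerUnit], by simp [cornerUnit, sub_eq_add_neg],
    by simp [cornerUnit, sub_eq_add_neg]⟩

/-- The four `cornerUnit` steps are the four `StepKind`s. [folklore] -/
theorem stepKind_add_cornerUnit (v : Site 2) (k : Fin 4) : StepKind v (v + cornerUnit k) := by
  obtain ⟨h0, h1, h2, h3⟩ := add_cornerUnit_apply v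
  fin_cases k
  · exact .right h0.1 h0.2
  · exact .up h1.2 h1.1
  · exact .left (by simp only [Fin.reduceFinMk]; omega) (by simp only [Fin.reduceFinMk]; omega)
  · exact .down (by simp only [Fin.reduceFinMk]; omega) (by simp only [Fin.reduceFinMk]; omega)

/-- `v` is adjacent in `ℤ²` to `v + cornerUnit k` (cf. `zdGraph_adj_add_cornerUnit` of
`InnerFacesHoleFree.lean`, not imported here). [folklore] -/
private theorem adj_add_cornerUnit (v : Site 2) (k : Fin 4) : (zdGraph 2).Adj v (v + cornerUnit k) :=
  adj_of_stepKind (stepKind_add_cornerUnit v k)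

/-- Every unit step of `ℤ²` is a `cornerUnit` step. [folklore] -/
theorem exists_eq_add_cornerUnit_of_stepKind {v w : Site 2} (h : StepKind v w) : ∃ k : Fin 4, w = v + cornerUnit k := by
  obtain ⟨h0, h1, h2, h3⟩ := add_cornerUnit_apply v
  rcases h with ⟨a0, a1⟩ | ⟨a0, a1⟩ | ⟨a1, a0⟩ | ⟨a1, a0⟩
  · exact ⟨0, Site.eq_iff_two.2 ⟨by omega, by omega⟩⟩
  · exact ⟨2, Site.eq_iff_two.2 ⟨by omega, by omega⟩⟩
  · exact ⟨1, Site.eq_iff_two.2 ⟨by omega, by omega⟩⟩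
  · exact ⟨3, Site.eq_iff_two.2 ⟨by omega, by omega⟩⟩

/-- Every adjacency of `ℤ²` is a `cornerUnit` step. [folklore] -/
theorem exists_eq_add_cornerUnit_of_adj {v w : Site 2} (h : (zdGraph 2).Adj v w) : ∃ k : Fin 4, w = v + cornerUnit k :=
  exists_eq_add_cornerUnit_of_stepKind (stepKind_of_adj h)

/-- The outer boundary of `S` in terms of adjacency: the sites outside `S` adjacent to `S`. [folklore] -/
theorem mem_latticeOuterBoundary_iff {S : Set (Site 2)} {w : Site 2} :
    w ∈ latticeOuterBoundary S ↔ w ∉ S ∧ ∃ v ∈ S, (zdGraph 2).Adj v w := by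
  constructor
  · rintro ⟨hw, v, hv, k, rfl⟩
    exact ⟨hw, v, hv, adj_add_cornerUnit v k⟩
  · rintro ⟨hw, v, hv, hadj⟩
    obtain ⟨k, rfl⟩ := exists_eq_add_cornerUnit_of_adj hadj
    exact ⟨hw, v, hv, k, rfl⟩

/-- A site outside `S` adjacent to a site of `S` is on the outer boundary. [folklore] -/
theorem mem_latticeOuterBoundary_of_adj {S : Set (Site 2)} {v w : Site 2} (hv : v ∈ S) (hw : w ∉ S)
    (h : (zdGraph 2).Adj v w) : w ∈ latticeOuterBoundary S :=
  mem_latticeOuterBoundary_iff.2 ⟨hw, v, hv, h⟩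

/-- Along a unit step both coordinates change by at most one, and the sup-distance by exactly one
in one coordinate. [folklore] -/
theorem coord_step_of_stepKind {v w : Site 2} (h : StepKind v w) :
    (w 0 = v 0 + 1 ∧ w 1 = v 1) ∨ (w 0 = v 0 - 1 ∧ w 1 = v 1) ∨ (w 0 = v 0 ∧ w 1 = v 1 + 1) ∨ (w 0 = v 0 ∧ w 1 = v 1 - 1) := by
  rcases h with ⟨a0, a1⟩ | ⟨a0, a1⟩ | ⟨a1, a0⟩ | ⟨a1, a0⟩
  · exact Or.inl ⟨a0, a1⟩
  · exact Or.inr (Or.inl ⟨by omega, a1⟩)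
  · exact Or.inr (Or.inr (Or.inl ⟨a0, a1⟩))
  · exact Or.inr (Or.inr (Or.inr ⟨a0, by omega⟩))

/-- Coordinates change by at most one along an adjacency of `ℤ²`. [folklore] -/
theorem coord_step_of_adj {v w : Site 2} (h : (zdGraph 2).Adj v w) :
    (w 0 = v 0 + 1 ∧ w 1 = v 1) ∨ (w 0 = v 0 - 1 ∧ w 1 = v 1) ∨ (w 0 = v 0 ∧ w 1 = v 1 + 1) ∨ (w 0 = v 0 ∧ w 1 = v 1 - 1) :=
  coord_step_of_stepKind (stepKind_of_adj h)

/-- The closed square box of sup-radius `n` about `p`: `{z | |z₀ - p₀| ≤ n ∧ |z₁ - p₁| ≤ n}`. [folklore] -/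
def sqBox (p : Site 2) (n : ℤ) : Set (Site 2) := {z | |z 0 - p 0| ≤ n ∧ |z 1 - p 1| ≤ n}

/-- Membership in `sqBox`. [folklore] -/
@[simp] theorem mem_sqBox {p z : Site 2} {n : ℤ} : z ∈ sqBox p n ↔ |z 0 - p 0| ≤ n ∧ |z 1 - p 1| ≤ n := Iff.rfl

/-- Boxes are monotone in the radius. [folklore] -/
theorem sqBox_mono (p : Site 2) {n n' : ℤ} (h : n ≤ n') : sqBox p n ⊆ sqBox p n' := by
  intro z hz
  rw [mem_sqBox] at hz ⊢
  exact ⟨hz.1.trans h, hz.2.trans h⟩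

/-- The box of radius `n` is the image of a finite product of intervals, hence finite. [folklore] -/
theorem sqBox_finite (p : Site 2) (n : ℤ) : (sqBox p n).Finite := by
  have hsub : sqBox p n ⊆ (fun f : Fin 2 → ℤ => f) '' (Set.pi Set.univ fun i : Fin 2 => Set.Icc (p i - n) (p i + n)) := by
    intro z hz
    refine ⟨z, ?_, rfl⟩
    rw [Set.mem_univ_pi]
    intro i
    rw [mem_sqBox, abs_le, abs_le] at hz
    fin_cases i
    · simp only [Fin.zero_eta, Set.mem_Icc]; constructor <;> linarith [hz.1.1, hz.1.2]
    · simp only [Fin.mk_one, Set.mem_Icc]; constructor <;> linarith [hz.2.1, hz.2.2]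
  refine Set.Finite.subset ?_ hsub
  exact (Set.Finite.pi fun i => Set.finite_Icc _ _).image _

/-- A neighbour of a point of `sqBox p n` lies in `sqBox p (n + 1)`. [folklore] -/
theorem mem_sqBox_succ_of_adj {p v w : Site 2} {n : ℤ} (hv : v ∈ sqBox p n) (h : (zdGraph 2).Adj v w) :
    w ∈ sqBox p (n + 1) := by
  rw [mem_sqBox, abs_le, abs_le] at hv ⊢
  rcases coord_step_of_adj h with ⟨h0, h1⟩ | ⟨h0, h1⟩ | ⟨h0, h1⟩ | ⟨h0, h1⟩ <;> omega

/-! ### §1. Supplements on the winding number of lattice walks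

`Literature.Probability.Percolation.walkWinding p u` (from `PlanarDuality.lean`) is the signed
number of vertical steps of the walk `p` through the horizontal half-line at height `u₁ + ½`
to the right of `u₀ + ½`. We add: it vanishes when the walk stays weakly left of `u`; it
telescopes when the walk stays strictly right of `u`; and for a *closed* walk it is constant
along any lattice walk avoiding it (no endpoint condition is needed, the boundary term of
`walkWinding_sub_walkWinding_up` cancelling for `a = b`). -/

variable {a b : Site 2}

/-- No winding for a walk staying weakly to the left of the base point. [folklore] -/
theorem walkWinding_eq_zero_of_left {p : (zdGraph 2).Walk a b} {u : Site 2}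
    (hp : ∀ z ∈ p.support, z 0 ≤ u 0) : walkWinding p u = 0 := by
  induction p with
  | nil => rfl
  | cons h p ih =>
    rename_i x y z
    rw [walkWinding_cons, ih fun w hw => hp w (by simp [hw]), add_zero]
    have hx := hp x (by simp)
    unfold stepWinding upStep
    split_ifs <;> omega

/-- **Telescoping to the right.** For a walk staying strictly to the right of the base point `u`,
the winding number is `[u₁ + 1 ≤ b₁] - [u₁ + 1 ≤ a₁]`. [folklore] -/
theorem walkWinding_eq_of_right {p : (zdGraph 2).Walk a b} {u : Site 2}
    (hp : ∀ z ∈ p.support, u 0 + 1 ≤ z 0) :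
    walkWinding p u = (if u 1 + 1 ≤ b 1 then 1 else 0) - (if u 1 + 1 ≤ a 1 then 1 else 0) := by
  induction p with
  | nil => simp
  | cons h p ih =>
    rename_i x y z
    rw [walkWinding_cons, ih fun w hw => hp w (by simp [hw])]
    have hx := hp x (by simp)
    have hy := hp y (by simp)
    have hk := stepKind_of_adj h
    unfold stepWinding upStep
    rcases hk with ⟨a0, a1⟩ | ⟨a0, a1⟩ | ⟨a1, a0⟩ | ⟨a1, a0⟩ <;> split_ifs <;> omega

/-- For a closed lattice walk, the winding number does not change across a lattice step between
two points off the walk. [folklore] -/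
theorem walkWinding_closed_eq_of_stepKind {p : (zdGraph 2).Walk a a} {v v' : Site 2} (hvv' : StepKind v v')
    (hv : v ∉ p.support) (hv' : v' ∉ p.support) : walkWinding p v = walkWinding p v' := by
  have notEdge : ∀ {x y : Site 2}, x ∉ p.support → s(x, y) ∉ p.edges :=
    fun hx he => hx (Walk.fst_mem_support_of_mem_edges p he)
  -- the vertical case, for a closed walk: no boundary term
  have up_case : ∀ {w : Site 2}, w + Pi.single 1 1 ∉ p.support →
      walkWinding p w = walkWinding p (w + Pi.single 1 1) := by
    intro w hw
    have hsum : (p.darts.map fun d => hCross w d.fst d.snd).sum = 0 := by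
      refine List.sum_eq_zero fun t ht => ?_
      obtain ⟨d, hd, rfl⟩ := List.mem_map.1 ht
      refine hCross_eq_zero_of_ne fun heq => notEdge (y := w + Pi.single 1 1 + Pi.single 0 1) hw ?_
      rw [← heq]
      exact List.mem_map.2 ⟨d, hd, rfl⟩
    have key := walkWinding_sub_walkWinding_up p w
    rw [hsum] at key
    simp only [sub_self, neg_zero] at key
    linarith
  rcases hvv' with ⟨h0, h1⟩ | ⟨h0, h1⟩ | ⟨h1, h0⟩ | ⟨h1, h0⟩
  · have hv'eq : v' = v + Pi.single 0 1 := by simp [Site.eq_iff_two, h0, h1]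
    rw [hv'eq]
    exact walkWinding_eq_walkWinding_right (notEdge (by rwa [← hv'eq]))
  · have hveq : v = v' + Pi.single 0 1 := by simp [Site.eq_iff_two, h0, h1]
    rw [hveq]
    exact (walkWinding_eq_walkWinding_right (notEdge (by rwa [← hveq]))).symm
  · have hv'eq : v' = v + Pi.single 1 1 := by simp [Site.eq_iff_two, h0, h1]
    rw [hv'eq] at hv' ⊢
    exact up_case hv'
  · have hveq : v = v' + Pi.single 1 1 := by simp [Site.eq_iff_two, h0, h1]
    rw [hveq] at hv ⊢
    exact (up_case hv).symm

/-- **Constancy along avoiding walks, closed case.** A closed lattice walk winds equally around the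
two ends of any lattice walk avoiding its vertices (Kesten 1982, §2.2). [folklore] -/
theorem walkWinding_closed_eq_of_walk (p : (zdGraph 2).Walk a a) {c d : Site 2} (q : (zdGraph 2).Walk c d)
    (hq : ∀ z ∈ q.support, z ∉ p.support) : walkWinding p c = walkWinding p d := by
  induction q with
  | nil => rfl
  | cons h q ih =>
    rename_i x y z
    rw [walkWinding_closed_eq_of_stepKind (stepKind_of_adj h) (hq x (by simp)) (hq y (by simp))]
    exact ih fun w hw => hq w (by simp [hw])

/-- Winding numbers of a walk inside the box `sqBox p n` vanish at every point outside that box. [folklore] -/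
theorem walkWinding_eq_zero_of_not_mem_sqBox {p₀ : Site 2} {n : ℤ} {p : (zdGraph 2).Walk a a}
    (hp : ∀ z ∈ p.support, z ∈ sqBox p₀ n) {d : Site 2} (hd : d ∉ sqBox p₀ n) : walkWinding p d = 0 := by
  simp only [mem_sqBox, not_and_or, not_le] at hd
  have hp' : ∀ z ∈ p.support, |z 0 - p₀ 0| ≤ n ∧ |z 1 - p₀ 1| ≤ n := fun z hz => hp z hz
  rcases hd with hd | hd
  · rcases lt_abs.1 hd with hd | hd
    · -- `d` to the right of the box
      exact walkWinding_eq_zero_of_left fun z hz => by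
        have := (abs_le.1 (hp' z hz).1).2; omega
    · -- `d` to the left of the box: telescoping with `a = a`
      rw [walkWinding_eq_of_right fun z hz => ?_, sub_self]
      have := (abs_le.1 (hp' z hz).1).1; omega
  · rcases lt_abs.1 hd with hd | hd
    · exact walkWinding_eq_zero_of_le (N := p₀ 1 + n) (fun z hz => by
        have := (abs_le.1 (hp' z hz).2).2; omega) (by omega)
    · exact walkWinding_eq_zero_of_ge (L := p₀ 1 - n) (fun z hz => by
        have := (abs_le.1 (hp' z hz).2).1; omega) (by omega)

/-- **A closed walk winding around `p₀` meets every lattice walk from `p₀` leaving its box.** If a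
closed walk inside `sqBox p₀ n` has non-zero winding number about `p₀`, then every lattice walk
from `p₀` to a point outside `sqBox p₀ n` shares a vertex with it (discrete Jordan-curve
argument, Kesten 1982, §2.2). [folklore] -/
theorem exists_mem_support_of_walkWinding_ne_zero {p₀ : Site 2} {n : ℤ} {p : (zdGraph 2).Walk a a}
    (hp : ∀ z ∈ p.support, z ∈ sqBox p₀ n) (hw : walkWinding p p₀ ≠ 0) {d : Site 2} (hd : d ∉ sqBox p₀ n)
    (q : (zdGraph 2).Walk p₀ d) : ∃ z ∈ q.support, z ∈ p.support := by
  by_contra hcon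
  push Not at hcon
  have h1 := walkWinding_closed_eq_of_walk p q hcon
  rw [walkWinding_eq_zero_of_not_mem_sqBox hp hd] at h1
  exact hw h1


/-! ### §2. Lattice walks: exit prefixes, sub-walks, and the four strips of a square annulus -/

/-- **Exit prefix.** A lattice walk from a point outside `K` to a point of `K` has an initial
segment staying outside `K` and ending at a point adjacent to `K`. [folklore] -/
theorem exists_prefix_not_mem (K : Set (Site 2)) :
    ∀ {a b : Site 2} (P : (zdGraph 2).Walk a b), a ∉ K → b ∈ K →
      ∃ (u u' : Site 2) (P' : (zdGraph 2).Walk a u), u ∉ K ∧ u' ∈ K ∧ (zdGraph 2).Adj u u' ∧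
        ∀ z ∈ P'.support, z ∈ P.support ∧ z ∉ K := by
  intro a b P
  induction P with
  | nil => intro ha hb; exact absurd hb ha
  | cons h P ih =>
    rename_i x y z
    intro hx hz
    by_cases hy : y ∈ K
    · refine ⟨x, y, Walk.nil, hx, hy, h, fun w hw => ?_⟩
      rw [Walk.support_nil, List.mem_singleton] at hw
      subst hw
      exact ⟨by simp, hx⟩
    · obtain ⟨u, u', P', hu, hu', hadj, hsup⟩ := ih hy hz
      refine ⟨u, u', Walk.cons h P', hu, hu', hadj, fun w hw => ?_⟩
      rw [Walk.support_cons, List.mem_cons] at hw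
      rcases hw with rfl | hw
      · exact ⟨by simp, hx⟩
      · exact ⟨by simp [(hsup w hw).1], (hsup w hw).2⟩

/-- A walk between any two of its vertices, inside its support. [folklore] -/
theorem exists_walk_of_mem_support {x y u v : Site 2} (P : (zdGraph 2).Walk x y) (hu : u ∈ P.support)
    (hv : v ∈ P.support) : ∃ Q : (zdGraph 2).Walk u v, ∀ z ∈ Q.support, z ∈ P.support := by
  classical
  refine ⟨(P.takeUntil u hu).reverse.append (P.takeUntil v hv), fun z hz => ?_⟩
  rw [Walk.mem_support_append_iff, Walk.support_reverse, List.mem_reverse] at hz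
  rcases hz with hz | hz
  · exact P.support_takeUntil_subset_support hu hz
  · exact P.support_takeUntil_subset_support hv hz

/-- Prefix of a walk up to the column `c - 1`, for a walk starting left of column `c` and ending
at or right of it. [folklore] -/
theorem exists_prefix_col_le {a b : Site 2} (P : (zdGraph 2).Walk a b) {c : ℤ} (ha : a 0 ≤ c - 1) (hb : c ≤ b 0) :
    ∃ (u : Site 2) (P' : (zdGraph 2).Walk a u), u 0 = c - 1 ∧ ∀ z ∈ P'.support, z ∈ P.support ∧ z 0 ≤ c - 1 := by
  obtain ⟨u, u', P', hu, hu', hadj, hsup⟩ := exists_prefix_not_mem {z : Site 2 | c ≤ z 0} P (by simp; omega) (by simpa)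
  simp only [Set.mem_setOf_eq, not_le] at hu hu'
  refine ⟨u, P', ?_, fun z hz => ⟨(hsup z hz).1, by have := (hsup z hz).2; simp at this; omega⟩⟩
  rcases coord_step_of_adj hadj with ⟨h0, -⟩ | ⟨h0, -⟩ | ⟨h0, -⟩ | ⟨h0, -⟩ <;> omega

/-- Suffix of a walk from the column `c + 1`, for a walk starting at or left of column `c` and
ending right of it. [folklore] -/
theorem exists_suffix_col_ge {a b : Site 2} (P : (zdGraph 2).Walk a b) {c : ℤ} (ha : a 0 ≤ c) (hb : c + 1 ≤ b 0) :
    ∃ (u : Site 2) (P' : (zdGraph 2).Walk u b), u 0 = c + 1 ∧ ∀ z ∈ P'.support, z ∈ P.support ∧ c + 1 ≤ z 0 := by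
  obtain ⟨u, u', P', hu, hu', hadj, hsup⟩ := exists_prefix_not_mem {z : Site 2 | z 0 ≤ c} P.reverse (by simp; omega) (by simpa)
  simp only [Set.mem_setOf_eq, not_le] at hu hu'
  refine ⟨u, P'.reverse, ?_, fun z hz => ?_⟩
  · rcases coord_step_of_adj hadj with ⟨h0, -⟩ | ⟨h0, -⟩ | ⟨h0, -⟩ | ⟨h0, -⟩ <;> omega
  · rw [Walk.support_reverse, List.mem_reverse] at hz
    have h1 := hsup z hz
    rw [Walk.support_reverse, List.mem_reverse] at h1
    simp only [Set.mem_setOf_eq, not_le] at h1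
    exact ⟨h1.1, by omega⟩

/-- Prefix of a walk up to the row `c - 1` (coordinate `1`). [folklore] -/
theorem exists_prefix_row_le {a b : Site 2} (P : (zdGraph 2).Walk a b) {c : ℤ} (ha : a 1 ≤ c - 1) (hb : c ≤ b 1) :
    ∃ (u : Site 2) (P' : (zdGraph 2).Walk a u), u 1 = c - 1 ∧ ∀ z ∈ P'.support, z ∈ P.support ∧ z 1 ≤ c - 1 := by
  obtain ⟨u, u', P', hu, hu', hadj, hsup⟩ := exists_prefix_not_mem {z : Site 2 | c ≤ z 1} P (by simp; omega) (by simpa)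
  simp only [Set.mem_setOf_eq, not_le] at hu hu'
  refine ⟨u, P', ?_, fun z hz => ⟨(hsup z hz).1, by have := (hsup z hz).2; simp at this; omega⟩⟩
  rcases coord_step_of_adj hadj with ⟨-, h1⟩ | ⟨-, h1⟩ | ⟨-, h1⟩ | ⟨-, h1⟩ <;> omega

/-- Suffix of a walk from the row `c + 1` (coordinate `1`). [folklore] -/
theorem exists_suffix_row_ge {a b : Site 2} (P : (zdGraph 2).Walk a b) {c : ℤ} (ha : a 1 ≤ c) (hb : c + 1 ≤ b 1) :
    ∃ (u : Site 2) (P' : (zdGraph 2).Walk u b), u 1 = c + 1 ∧ ∀ z ∈ P'.support, z ∈ P.support ∧ c + 1 ≤ z 1 := by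
  obtain ⟨u, u', P', hu, hu', hadj, hsup⟩ := exists_prefix_not_mem {z : Site 2 | z 1 ≤ c} P.reverse (by simp; omega) (by simpa)
  simp only [Set.mem_setOf_eq, not_le] at hu hu'
  refine ⟨u, P'.reverse, ?_, fun z hz => ?_⟩
  · rcases coord_step_of_adj hadj with ⟨-, h1⟩ | ⟨-, h1⟩ | ⟨-, h1⟩ | ⟨-, h1⟩ <;> omega
  · rw [Walk.support_reverse, List.mem_reverse] at hz
    have h1 := hsup z hz
    rw [Walk.support_reverse, List.mem_reverse] at h1
    simp only [Set.mem_setOf_eq, not_le] at h1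
    exact ⟨h1.1, by omega⟩

/-- `Fin.rev` on `Fin 2` exchanges the two coordinates. [folklore] -/
@[simp] private theorem rev_zero_fin_two : (0 : Fin 2).rev = 1 := rfl

/-- `Fin.rev` on `Fin 2` exchanges the two coordinates. [folklore] -/
@[simp] private theorem rev_one_fin_two : (1 : Fin 2).rev = 0 := rfl

/-- The **strip** of the square annulus `sqBox p m ∖ sqBox p n` facing the direction `(i, s)`
(`i` the normal coordinate, `s = ±1` its sign): `n + 1 ≤ s (z_i - p_i) ≤ m` and `|z_{i'} - p_{i'}| ≤ m`
for the other coordinate `i' = i.rev`. The four strips (top `(1, 1)`, bottom `(1, -1)`, right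
`(0, 1)`, left `(0, -1)`) cover the annulus and overlap in its four corner squares. [folklore] -/
def strip (p : Site 2) (i : Fin 2) (s n m : ℤ) : Set (Site 2) :=
  {z | n + 1 ≤ s * (z i - p i) ∧ s * (z i - p i) ≤ m ∧ |z i.rev - p i.rev| ≤ m}

/-- Membership in a strip. [folklore] -/
theorem mem_strip {p z : Site 2} {i : Fin 2} {s n m : ℤ} :
    z ∈ strip p i s n m ↔ n + 1 ≤ s * (z i - p i) ∧ s * (z i - p i) ≤ m ∧ |z i.rev - p i.rev| ≤ m := Iff.rfl

/-- Strips lie in the outer box. [folklore] -/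
theorem strip_subset_sqBox {p : Site 2} {i : Fin 2} {s n m : ℤ} (hs : s = 1 ∨ s = -1) (hn : 0 ≤ n) :
    strip p i s n m ⊆ sqBox p m := by
  intro z hz
  rw [mem_strip] at hz
  rw [mem_sqBox]
  fin_cases i <;> simp only [Fin.zero_eta, Fin.mk_one, rev_zero_fin_two, rev_one_fin_two] at hz <;>
    rcases hs with rfl | rfl <;> refine ⟨?_, ?_⟩ <;> first | exact hz.2.2 | (rw [abs_le]; constructor <;> nlinarith [hz.1, hz.2.1])

/-- Strips are disjoint from the inner box. [folklore] -/
theorem not_mem_sqBox_of_mem_strip {p z : Site 2} {i : Fin 2} {s n m : ℤ} (hs : s = 1 ∨ s = -1) (hz : z ∈ strip p i s n m) :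
    z ∉ sqBox p n := by
  rw [mem_strip] at hz
  rw [mem_sqBox, abs_le, abs_le]
  fin_cases i <;> simp only [Fin.zero_eta, Fin.mk_one] at hz <;> rcases hs with rfl | rfl <;> omega

/-- A **long crossing** of the strip `(i, s)` inside `S`: a lattice walk in `S ∩ strip` joining its
two short sides `z_{i'} = p_{i'} - m` and `z_{i'} = p_{i'} + m`. [folklore] -/
def HasLongCrossing (S : Set (Site 2)) (p : Site 2) (i : Fin 2) (s n m : ℤ) : Prop :=
  ∃ (x y : Site 2) (P : (zdGraph 2).Walk x y), x i.rev = p i.rev - m ∧ y i.rev = p i.rev + m ∧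
    ∀ z ∈ P.support, z ∈ S ∧ z ∈ strip p i s n m

/-- Winding of a circuit made of four pieces lying in the four strips: only the piece in the
right strip winds, by `-1` (it descends through the half-line to the right of `p`). [folklore] -/
theorem walkWinding_four_pieces {p z₁ z₂ z₃ z₄ : Site 2} {n : ℤ} (hn : 1 ≤ n)
    (WT : (zdGraph 2).Walk z₄ z₁) (WR : (zdGraph 2).Walk z₁ z₂) (WB : (zdGraph 2).Walk z₂ z₃) (WL : (zdGraph 2).Walk z₃ z₄)
    (hWT : ∀ z ∈ WT.support, p 1 + n + 1 ≤ z 1) (hWR : ∀ z ∈ WR.support, p 0 + n + 1 ≤ z 0)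
    (hWB : ∀ z ∈ WB.support, z 1 ≤ p 1 - n - 1) (hWL : ∀ z ∈ WL.support, z 0 ≤ p 0 - n - 1)
    (h₁ : p 1 + n + 1 ≤ z₁ 1) (h₂ : z₂ 1 ≤ p 1 - n - 1) :
    walkWinding (((WT.append WR).append WB).append WL) p = -1 := by
  have e1 : ¬ (p 1 + 1 ≤ z₂ 1) := by omega
  have e2 : p 1 + 1 ≤ z₁ 1 := by omega
  rw [walkWinding_append, walkWinding_append, walkWinding_append,
    walkWinding_eq_zero_of_ge (L := p 1 + n + 1) hWT (by omega),
    walkWinding_eq_of_right (u := p) (fun z hz => by have := hWR z hz; omega),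
    walkWinding_eq_zero_of_le (N := p 1 - n - 1) hWB (by omega),
    walkWinding_eq_zero_of_left (u := p) (fun z hz => by have := hWL z hz; omega),
    if_neg e1, if_pos e2]
  norm_num

/-- Coordinates of the points of a walk inside a strip, top case. [folklore] -/
theorem coords_of_strip_top {p z : Site 2} {n m : ℤ} (h : z ∈ strip p 1 1 n m) :
    p 1 + n + 1 ≤ z 1 ∧ z 1 ≤ p 1 + m ∧ p 0 - m ≤ z 0 ∧ z 0 ≤ p 0 + m := by
  rw [mem_strip] at h; simp only [rev_one_fin_two, abs_le] at h; omega

/-- Coordinates of the points of a walk inside a strip, bottom case. [folklore] -/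
theorem coords_of_strip_bottom {p z : Site 2} {n m : ℤ} (h : z ∈ strip p 1 (-1) n m) :
    p 1 - m ≤ z 1 ∧ z 1 ≤ p 1 - n - 1 ∧ p 0 - m ≤ z 0 ∧ z 0 ≤ p 0 + m := by
  rw [mem_strip] at h; simp only [rev_one_fin_two, abs_le] at h; omega

/-- Coordinates of the points of a walk inside a strip, right case. [folklore] -/
theorem coords_of_strip_right {p z : Site 2} {n m : ℤ} (h : z ∈ strip p 0 1 n m) :
    p 0 + n + 1 ≤ z 0 ∧ z 0 ≤ p 0 + m ∧ p 1 - m ≤ z 1 ∧ z 1 ≤ p 1 + m := by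
  rw [mem_strip] at h; simp only [rev_zero_fin_two, abs_le] at h; omega

/-- Coordinates of the points of a walk inside a strip, left case. [folklore] -/
theorem coords_of_strip_left {p z : Site 2} {n m : ℤ} (h : z ∈ strip p 0 (-1) n m) :
    p 0 - m ≤ z 0 ∧ z 0 ≤ p 0 - n - 1 ∧ p 1 - m ≤ z 1 ∧ z 1 ≤ p 1 + m := by
  rw [mem_strip] at h; simp only [rev_zero_fin_two, abs_le] at h; omega

/-- Corner `TR`: a top crossing and a right crossing meet above row `p₁ + n`. [folklore] -/
theorem corner_TR {p xT yT xR yR : Site 2} {n m : ℤ} (PT : (zdGraph 2).Walk xT yT) (PR : (zdGraph 2).Walk xR yR)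
    (cT : ∀ z ∈ PT.support, p 1 + n + 1 ≤ z 1 ∧ z 1 ≤ p 1 + m ∧ p 0 - m ≤ z 0 ∧ z 0 ≤ p 0 + m)
    (cR : ∀ z ∈ PR.support, p 0 + n + 1 ≤ z 0 ∧ z 0 ≤ p 0 + m ∧ p 1 - m ≤ z 1 ∧ z 1 ≤ p 1 + m)
    (hxT : xT 0 ≤ p 0 + n) (hyT : yT 0 = p 0 + m) (hxR : xR 1 ≤ p 1 + n) (hyR : yR 1 = p 1 + m) (hnm : n + 1 ≤ m) :
    ∃ z, z ∈ PT.support ∧ z ∈ PR.support ∧ p 1 + n + 1 ≤ z 1 := by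
  obtain ⟨u, PT', hu, hPT'⟩ := exists_suffix_col_ge PT (c := p 0 + n) hxT (by omega)
  obtain ⟨w, PR', hw, hPR'⟩ := exists_suffix_row_ge PR (c := p 1 + n) hxR (by omega)
  obtain ⟨z, hzT, hzR⟩ := exists_mem_support_of_crossing (L := p 0 + n + 1) (R := p 0 + m) (B := p 1 + n + 1) (T := p 1 + m)
    PT' PR' (fun z hz => by have h1 := cT z (hPT' z hz).1; have h2 := (hPT' z hz).2; omega)
    (fun z hz => by have h1 := cR z (hPR' z hz).1; have h2 := (hPR' z hz).2; omega) hu hyT hw hyR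
  exact ⟨z, (hPT' z hzT).1, (hPR' z hzR).1, (hPR' z hzR).2⟩

/-- Corner `BR`: a bottom crossing and a right crossing meet below row `p₁ - n`. [folklore] -/
theorem corner_BR {p xB yB xR yR : Site 2} {n m : ℤ} (PB : (zdGraph 2).Walk xB yB) (PR : (zdGraph 2).Walk xR yR)
    (cB : ∀ z ∈ PB.support, p 1 - m ≤ z 1 ∧ z 1 ≤ p 1 - n - 1 ∧ p 0 - m ≤ z 0 ∧ z 0 ≤ p 0 + m)
    (cR : ∀ z ∈ PR.support, p 0 + n + 1 ≤ z 0 ∧ z 0 ≤ p 0 + m ∧ p 1 - m ≤ z 1 ∧ z 1 ≤ p 1 + m)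
    (hxB : xB 0 ≤ p 0 + n) (hyB : yB 0 = p 0 + m) (hxR : xR 1 = p 1 - m) (hyR : p 1 - n ≤ yR 1) (hnm : n + 1 ≤ m) :
    ∃ z, z ∈ PB.support ∧ z ∈ PR.support ∧ z 1 ≤ p 1 - n - 1 := by
  obtain ⟨u, PB', hu, hPB'⟩ := exists_suffix_col_ge PB (c := p 0 + n) hxB (by omega)
  obtain ⟨w, PR', hw, hPR'⟩ := exists_prefix_row_le PR (c := p 1 - n) (by omega) hyR
  obtain ⟨z, hzB, hzR⟩ := exists_mem_support_of_crossing (L := p 0 + n + 1) (R := p 0 + m) (B := p 1 - m) (T := p 1 - n - 1)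
    PB' PR' (fun z hz => by have h1 := cB z (hPB' z hz).1; have h2 := (hPB' z hz).2; omega)
    (fun z hz => by have h1 := cR z (hPR' z hz).1; have h2 := (hPR' z hz).2; omega) hu hyB hxR hw
  exact ⟨z, (hPB' z hzB).1, (hPR' z hzR).1, (hPR' z hzR).2⟩

/-- Corner `BL`: a bottom crossing and a left crossing meet. [folklore] -/
theorem corner_BL {p xB yB xL yL : Site 2} {n m : ℤ} (PB : (zdGraph 2).Walk xB yB) (PL : (zdGraph 2).Walk xL yL)
    (cB : ∀ z ∈ PB.support, p 1 - m ≤ z 1 ∧ z 1 ≤ p 1 - n - 1 ∧ p 0 - m ≤ z 0 ∧ z 0 ≤ p 0 + m)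
    (cL : ∀ z ∈ PL.support, p 0 - m ≤ z 0 ∧ z 0 ≤ p 0 - n - 1 ∧ p 1 - m ≤ z 1 ∧ z 1 ≤ p 1 + m)
    (hxB : xB 0 = p 0 - m) (hyB : p 0 - n ≤ yB 0) (hxL : xL 1 = p 1 - m) (hyL : p 1 - n ≤ yL 1) (hnm : n + 1 ≤ m) :
    ∃ z, z ∈ PB.support ∧ z ∈ PL.support := by
  obtain ⟨u, PB', hu, hPB'⟩ := exists_prefix_col_le PB (c := p 0 - n) (by omega) hyB
  obtain ⟨w, PL', hw, hPL'⟩ := exists_prefix_row_le PL (c := p 1 - n) (by omega) hyL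
  obtain ⟨z, hzB, hzL⟩ := exists_mem_support_of_crossing (L := p 0 - m) (R := p 0 - n - 1) (B := p 1 - m) (T := p 1 - n - 1)
    PB' PL' (fun z hz => by have h1 := cB z (hPB' z hz).1; have h2 := (hPB' z hz).2; omega)
    (fun z hz => by have h1 := cL z (hPL' z hz).1; have h2 := (hPL' z hz).2; omega) hxB hu hxL hw
  exact ⟨z, (hPB' z hzB).1, (hPL' z hzL).1⟩

/-- Corner `TL`: a top crossing and a left crossing meet. [folklore] -/
theorem corner_TL {p xT yT xL yL : Site 2} {n m : ℤ} (PT : (zdGraph 2).Walk xT yT) (PL : (zdGraph 2).Walk xL yL)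
    (cT : ∀ z ∈ PT.support, p 1 + n + 1 ≤ z 1 ∧ z 1 ≤ p 1 + m ∧ p 0 - m ≤ z 0 ∧ z 0 ≤ p 0 + m)
    (cL : ∀ z ∈ PL.support, p 0 - m ≤ z 0 ∧ z 0 ≤ p 0 - n - 1 ∧ p 1 - m ≤ z 1 ∧ z 1 ≤ p 1 + m)
    (hxT : xT 0 = p 0 - m) (hyT : p 0 - n ≤ yT 0) (hxL : xL 1 ≤ p 1 + n) (hyL : yL 1 = p 1 + m) (hnm : n + 1 ≤ m) :
    ∃ z, z ∈ PT.support ∧ z ∈ PL.support := by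
  obtain ⟨u, PT', hu, hPT'⟩ := exists_prefix_col_le PT (c := p 0 - n) (by omega) hyT
  obtain ⟨w, PL', hw, hPL'⟩ := exists_suffix_row_ge PL (c := p 1 + n) hxL (by omega)
  obtain ⟨z, hzT, hzL⟩ := exists_mem_support_of_crossing (L := p 0 - m) (R := p 0 - n - 1) (B := p 1 + n + 1) (T := p 1 + m)
    PT' PL' (fun z hz => by have h1 := cT z (hPT' z hz).1; have h2 := (hPT' z hz).2; omega)
    (fun z hz => by have h1 := cL z (hPL' z hz).1; have h2 := (hPL' z hz).2; omega) hxT hu hw hyL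
  exact ⟨z, (hPT' z hzT).1, (hPL' z hzL).1⟩

/-- **Four long crossings splice into a circuit.** If `S` contains long crossings of all four
strips of the annulus `sqBox p m ∖ sqBox p n` (`1 ≤ n < m`), then `S ∩ sqBox p m ∖ sqBox p n`
contains a closed lattice walk of winding number `-1` about `p`: consecutive crossings meet in
the corner squares by the planar crossing lemma `exists_mem_support_of_crossing`, and the winding
of the resulting circuit is read off strip by strip. [folklore] -/
theorem exists_circuit_of_longCrossings {S : Set (Site 2)} {p : Site 2} {n m : ℤ} (hn : 1 ≤ n) (hnm : n + 1 ≤ m)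
    (hT : HasLongCrossing S p 1 1 n m) (hB : HasLongCrossing S p 1 (-1) n m)
    (hR : HasLongCrossing S p 0 1 n m) (hL : HasLongCrossing S p 0 (-1) n m) :
    ∃ (c : Site 2) (W : (zdGraph 2).Walk c c),
      (∀ z ∈ W.support, z ∈ S ∧ z ∈ sqBox p m ∧ z ∉ sqBox p n) ∧ walkWinding W p = -1 := by
  obtain ⟨xT, yT, PT, hxT, hyT, hPT⟩ := hT
  obtain ⟨xB, yB, PB, hxB, hyB, hPB⟩ := hB
  obtain ⟨xR, yR, PR, hxR, hyR, hPR⟩ := hR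
  obtain ⟨xL, yL, PL, hxL, hyL, hPL⟩ := hL
  rw [rev_one_fin_two] at hxT hyT hxB hyB
  rw [rev_zero_fin_two] at hxR hyR hxL hyL
  -- coordinates inside the four strips
  have cT : ∀ z ∈ PT.support, p 1 + n + 1 ≤ z 1 ∧ z 1 ≤ p 1 + m ∧ p 0 - m ≤ z 0 ∧ z 0 ≤ p 0 + m :=
    fun z hz => coords_of_strip_top (hPT z hz).2
  have cB : ∀ z ∈ PB.support, p 1 - m ≤ z 1 ∧ z 1 ≤ p 1 - n - 1 ∧ p 0 - m ≤ z 0 ∧ z 0 ≤ p 0 + m :=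
    fun z hz => coords_of_strip_bottom (hPB z hz).2
  have cR : ∀ z ∈ PR.support, p 0 + n + 1 ≤ z 0 ∧ z 0 ≤ p 0 + m ∧ p 1 - m ≤ z 1 ∧ z 1 ≤ p 1 + m :=
    fun z hz => coords_of_strip_right (hPR z hz).2
  have cL : ∀ z ∈ PL.support, p 0 - m ≤ z 0 ∧ z 0 ≤ p 0 - n - 1 ∧ p 1 - m ≤ z 1 ∧ z 1 ≤ p 1 + m :=
    fun z hz => coords_of_strip_left (hPL z hz).2
  -- the four corners
  obtain ⟨z₁, hz₁T, hz₁R, h₁⟩ := corner_TR PT PR cT cR (by omega) hyT (by omega) hyR hnm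
  obtain ⟨z₂, hz₂B, hz₂R, h₂⟩ := corner_BR PB PR cB cR (by omega) hyB hxR (by omega) hnm
  obtain ⟨z₃, hz₃B, hz₃L⟩ := corner_BL PB PL cB cL hxB (by omega) hxL (by omega) hnm
  obtain ⟨z₄, hz₄T, hz₄L⟩ := corner_TL PT PL cT cL hxT (by omega) (by omega) hyL hnm
  -- the four pieces of the circuit
  obtain ⟨WT, hWT⟩ := exists_walk_of_mem_support PT hz₄T hz₁T
  obtain ⟨WR, hWR⟩ := exists_walk_of_mem_support PR hz₁R hz₂R
  obtain ⟨WB, hWB⟩ := exists_walk_of_mem_support PB hz₂B hz₃B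
  obtain ⟨WL, hWL⟩ := exists_walk_of_mem_support PL hz₃L hz₄L
  have n0 : (0 : ℤ) ≤ n := by omega
  refine ⟨z₄, ((WT.append WR).append WB).append WL, fun z hz => ?_, ?_⟩
  · simp only [Walk.mem_support_append_iff] at hz
    rcases hz with ((hz | hz) | hz) | hz
    · exact ⟨(hPT z (hWT z hz)).1, strip_subset_sqBox (Or.inl rfl) n0 (hPT z (hWT z hz)).2,
        not_mem_sqBox_of_mem_strip (Or.inl rfl) (hPT z (hWT z hz)).2⟩
    · exact ⟨(hPR z (hWR z hz)).1, strip_subset_sqBox (Or.inl rfl) n0 (hPR z (hWR z hz)).2,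
        not_mem_sqBox_of_mem_strip (Or.inl rfl) (hPR z (hWR z hz)).2⟩
    · exact ⟨(hPB z (hWB z hz)).1, strip_subset_sqBox (Or.inr rfl) n0 (hPB z (hWB z hz)).2,
        not_mem_sqBox_of_mem_strip (Or.inr rfl) (hPB z (hWB z hz)).2⟩
    · exact ⟨(hPL z (hWL z hz)).1, strip_subset_sqBox (Or.inr rfl) n0 (hPL z (hWL z hz)).2,
        not_mem_sqBox_of_mem_strip (Or.inr rfl) (hPL z (hWL z hz)).2⟩
  · exact walkWinding_four_pieces hn WT WR WB WL (fun z hz => (cT z (hWT z hz)).1)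
      (fun z hz => (cR z (hWR z hz)).1) (fun z hz => (cB z (hWB z hz)).2.1)
      (fun z hz => (cL z (hWL z hz)).2.1) h₁ h₂

/-- **The cut forces a blocked strip.** If a lattice walk joins `p` to a point outside `sqBox p m`
avoiding `S`, then `S` cannot contain long crossings of all four strips of `sqBox p m ∖ sqBox p n`. [folklore] -/
theorem not_all_longCrossings_of_cut {S : Set (Site 2)} {p d : Site 2} {n m : ℤ} (hn : 1 ≤ n) (hnm : n + 1 ≤ m)
    (q : (zdGraph 2).Walk p d) (hd : d ∉ sqBox p m) (hq : ∀ z ∈ q.support, z ∉ S) :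
    ¬ (HasLongCrossing S p 1 1 n m ∧ HasLongCrossing S p 1 (-1) n m ∧
        HasLongCrossing S p 0 1 n m ∧ HasLongCrossing S p 0 (-1) n m) := by
  rintro ⟨hT, hB, hR, hL⟩
  obtain ⟨c, W, hW, hwind⟩ := exists_circuit_of_longCrossings hn hnm hT hB hR hL
  obtain ⟨z, hzq, hzW⟩ := exists_mem_support_of_walkWinding_ne_zero (fun z hz => (hW z hz).2.1)
    (by rw [hwind]; norm_num) hd q
  exact hq z hzq (hW z hzW).1


/-! ### §3. The barrier: the first sine mode of a lattice rectangle

For the rectangle `{1 ≤ X ≤ L, 1 ≤ Y ≤ M}` the function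
`v(X, Y) = sin(π X/(L+1)) · φ(Y)/φ(M+1)`, `φ = dstProfile L 1` (a multiple of `sinh (μ₁ Y)`,
`cosh μ₁ = 2 - cos(π/(L+1))`), is lattice harmonic, vanishes on three sides, is at most `1` on the
closed rectangle and at least `(2/5) e^{-4π}` on the zone `X/(L+1) ∈ [1/4, 3/4]`, `Y ≥ (L+1)/5`
when `M + 1 ≤ 4 (L + 1)`. By the comparison principle it bounds from below any nonnegative
superharmonic function which is `≥ γ` where the barrier is positive on the boundary. We write
the rectangle in a frame `(i, s, a, b)`: normal coordinate `i` with sign `s = ±1` and offset `b`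
(`Y = s (z_i - b)`), tangential coordinate `i.rev` with offset `a` (`X = z_{i.rev} - a`). -/

variable {L : ℕ} {μ : ℕ}

/-- The increments of the profile `φ_μ` dominate the first one: `φ(K+1) - φ(K) ≥ φ(1)` (`K ≥ 0`),
from the recurrence `φ(Y+1) + φ(Y-1) = 2c φ(Y)` with `c ≥ 1`, `φ ≥ 0`. [folklore] -/
theorem dstProfile_one_le_step (K : ℕ) :
    dstProfile L μ 1 ≤ dstProfile L μ ((K : ℤ) + 1) - dstProfile L μ K := by
  induction K with
  | zero => simp
  | succ K ih =>
    have hrec := dstProfile_rec (L := L) (m := μ) ((K : ℤ) + 1)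
    have hc := one_le_modeC (L := L) (m := μ)
    have hpos : 0 ≤ dstProfile L μ ((K : ℤ) + 1) := dstProfile_nonneg (by positivity)
    have e : (K : ℤ) + 1 - 1 = K := by ring
    rw [e] at hrec
    push_cast
    nlinarith

/-- **Superadditivity of the profile**: `K φ(1) ≤ φ(K)`. [folklore] -/
theorem nat_mul_dstProfile_one_le (K : ℕ) : (K : ℝ) * dstProfile L μ 1 ≤ dstProfile L μ K := by
  induction K with
  | zero => simp
  | succ K ih =>
    have h := dstProfile_one_le_step (L := L) (μ := μ) K
    push_cast
    linarith

/-- The profile is monotone on `ℕ`. [folklore] -/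
theorem dstProfile_mono_nat {K K' : ℕ} (h : K ≤ K') : dstProfile L μ K ≤ dstProfile L μ K' := by
  induction h with
  | refl => exact le_rfl
  | @step K' h ih =>
    have h1 := dstProfile_one_le_step (L := L) (μ := μ) K'
    have h2 : 0 ≤ dstProfile L μ 1 := dstProfile_nonneg (by norm_num)
    push_cast
    linarith

/-- `φ(K) ≤ e^{K θ}` (`r ≤ e^{θ}`). [folklore] -/
theorem dstProfile_le_exp (K : ℕ) : dstProfile L μ K ≤ Real.exp (K * dstAngle L μ) := by
  unfold dstProfile
  rw [zpow_natCast]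
  have h1 : dstR L μ ^ K ≤ Real.exp (dstAngle L μ) ^ K := pow_le_pow_left₀ dstR_pos.le dstR_le_exp _
  rw [← Real.exp_nat_mul] at h1
  have h2 : 0 ≤ dstR L μ ^ (-(K : ℤ)) := zpow_nonneg dstR_pos.le _
  linarith

/-- **Attenuation of the first mode**: for `Y ≥ (L+1)/5` and aspect `M + 1 ≤ 4 (L + 1)`,
`φ₁(Y)/φ₁(M+1) ≥ (4/5) e^{-4π}`. [folklore] -/
theorem le_dstProfile_ratio (hL : 1 ≤ L) {M : ℕ} (hM : M + 1 ≤ 4 * (L + 1)) {Y : ℕ} (hY : ((L : ℝ) + 1) / 5 ≤ Y) :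
    4 / 5 * Real.exp (-(4 * π)) ≤ dstProfile L 1 Y / dstProfile L 1 (M + 1) := by
  have hpos : 0 < dstProfile L 1 (M + 1) := dstProfile_pos le_rfl hL (by positivity)
  have hup : dstProfile L 1 (M + 1) ≤ Real.exp (4 * π) := by
    have h := dstProfile_le_exp (L := L) (μ := 1) (M + 1)
    push_cast at h
    refine h.trans ?_
    rw [Real.exp_le_exp]
    unfold dstAngle
    have hM' : ((M : ℝ) + 1) ≤ 4 * (L + 1) := by exact_mod_cast hM
    have hLp : (0 : ℝ) < L + 1 := by positivity
    calc ((M : ℝ) + 1) * ((1 : ℕ) * (π / (L + 1))) ≤ 4 * (L + 1) * ((1 : ℕ) * (π / (L + 1))) := by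
          gcongr
      _ = 4 * π := by rw [Nat.cast_one, one_mul]; field_simp
  have hlow : 4 / 5 ≤ dstProfile L 1 Y := by
    have h1 := nat_mul_dstProfile_one_le (L := L) (μ := 1) Y
    have h2 := le_modeProfile_one_first (L := L)
    have hLp : (0 : ℝ) < L + 1 := by positivity
    have h3 : ((L : ℝ) + 1) / 5 * (4 / ((L : ℝ) + 1)) ≤ (Y : ℝ) * dstProfile L 1 1 :=
      mul_le_mul hY h2 (by positivity) (by positivity)
    have e : ((L : ℝ) + 1) / 5 * (4 / ((L : ℝ) + 1)) = 4 / 5 := by field_simp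
    linarith
  rw [le_div_iff₀ hpos]
  calc 4 / 5 * Real.exp (-(4 * π)) * dstProfile L 1 (M + 1)
      ≤ 4 / 5 * Real.exp (-(4 * π)) * Real.exp (4 * π) := by gcongr
    _ = 4 / 5 := by rw [Real.exp_neg]; field_simp
    _ ≤ dstProfile L 1 Y := hlow

/-- The horizontal mode `sin(π X/(L+1))` lies in `[0, 1]` for `0 ≤ X ≤ L + 1`. [folklore] -/
theorem dstSin_one_mem_Icc {X : ℤ} (h0 : 0 ≤ X) (h1 : X ≤ L + 1) : 0 ≤ dstSin L 1 X ∧ dstSin L 1 X ≤ 1 := by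
  unfold dstSin
  refine ⟨Real.sin_nonneg_of_nonneg_of_le_pi ?_ ?_, Real.sin_le_one _⟩
  · have : (0 : ℝ) ≤ X := by exact_mod_cast h0
    positivity
  · have hX : (X : ℝ) ≤ L + 1 := by exact_mod_cast h1
    have hLp : (0 : ℝ) < L + 1 := by positivity
    calc ((1 : ℕ) : ℝ) * (X * (π / (L + 1))) ≤ (1 : ℕ) * ((L + 1) * (π / (L + 1))) := by gcongr
      _ = π := by rw [Nat.cast_one, one_mul]; field_simp

/-- The horizontal mode is at least `1/2` in the middle half `X/(L+1) ∈ [1/4, 3/4]`. [folklore] -/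
theorem half_le_dstSin_one {X : ℤ} (h0 : ((L : ℝ) + 1) / 4 ≤ X) (h1 : (X : ℝ) ≤ 3 * ((L : ℝ) + 1) / 4) :
    1 / 2 ≤ dstSin L 1 X := by
  unfold dstSin; simp only [Nat.cast_one, one_mul]
  have hLp : (0 : ℝ) < L + 1 := by positivity
  refine half_le_sin ?_ ?_
  · rw [show π / 4 = ((L : ℝ) + 1) / 4 * (π / (L + 1)) by field_simp]
    exact mul_le_mul_of_nonneg_right h0 (by positivity)
  · rw [show 3 * π / 4 = 3 * ((L : ℝ) + 1) / 4 * (π / (L + 1)) by field_simp]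
    exact mul_le_mul_of_nonneg_right h1 (by positivity)

/-- **Separable lattice-harmonic functions.** If `f(X+1) + f(X-1) = 2α f(X)` and
`g(Y+1) + g(Y-1) = 2β g(Y)` with `α + β = 2`, then `z ↦ f(z_{i.rev}) g(z_i)` is lattice harmonic
on `ℤ²` (for either choice of the coordinate `i`). [folklore] -/
theorem latticeLaplacian_separable (f g : ℤ → ℝ) {α β : ℝ} (hf : ∀ X, f (X + 1) + f (X - 1) = 2 * α * f X)
    (hg : ∀ Y, g (Y + 1) + g (Y - 1) = 2 * β * g Y) (hαβ : α + β = 2) (i : Fin 2) (z : Site 2) :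
    latticeLaplacian (fun w : Site 2 => f (w i.rev) * g (w i)) z = 0 := by
  rw [latticeLaplacian, Fin.sum_univ_four]
  obtain ⟨c0, c1, c2, c3⟩ := add_cornerUnit_apply z
  have hfz := hf (z i.rev)
  have hgz := hg (z i)
  fin_cases i
  · simp only [Fin.zero_eta, rev_zero_fin_two] at hfz hgz ⊢
    simp only [c0.1, c0.2, c1.1, c1.2, c2.1, c2.2, c3.1, c3.2]
    have e : f (z 1) * g (z 0 + 1) - f (z 1) * g (z 0) + (f (z 1 + 1) * g (z 0) - f (z 1) * g (z 0)) +
        (f (z 1) * g (z 0 - 1) - f (z 1) * g (z 0)) + (f (z 1 - 1) * g (z 0) - f (z 1) * g (z 0)) =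
        f (z 1) * (g (z 0 + 1) + g (z 0 - 1)) + (f (z 1 + 1) + f (z 1 - 1)) * g (z 0) - 4 * (f (z 1) * g (z 0)) := by ring
    rw [e, hfz, hgz]
    have : 2 * β + 2 * α - 4 = 0 := by linarith
    calc f (z 1) * (2 * β * g (z 0)) + 2 * α * f (z 1) * g (z 0) - 4 * (f (z 1) * g (z 0))
        = (2 * β + 2 * α - 4) * (f (z 1) * g (z 0)) := by ring
      _ = 0 := by rw [this]; ring
  · simp only [Fin.mk_one, rev_one_fin_two] at hfz hgz ⊢
    simp only [c0.1, c0.2, c1.1, c1.2, c2.1, c2.2, c3.1, c3.2]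
    have e : f (z 0 + 1) * g (z 1) - f (z 0) * g (z 1) + (f (z 0) * g (z 1 + 1) - f (z 0) * g (z 1)) +
        (f (z 0 - 1) * g (z 1) - f (z 0) * g (z 1)) + (f (z 0) * g (z 1 - 1) - f (z 0) * g (z 1)) =
        f (z 0) * (g (z 1 + 1) + g (z 1 - 1)) + (f (z 0 + 1) + f (z 0 - 1)) * g (z 1) - 4 * (f (z 0) * g (z 1)) := by ring
    rw [e, hfz, hgz]
    have : 2 * β + 2 * α - 4 = 0 := by linarith
    calc f (z 0) * (2 * β * g (z 1)) + 2 * α * f (z 0) * g (z 1) - 4 * (f (z 0) * g (z 1))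
        = (2 * β + 2 * α - 4) * (f (z 0) * g (z 1)) := by ring
      _ = 0 := by rw [this]; ring

/-- **The barrier** of the frame `(i, s, a, b)` and size `L × M`:
`v(z) = sin(π X/(L+1)) φ₁(Y)/φ₁(M+1)` with `X = z_{i.rev} - a`, `Y = s (z_i - b)`. [folklore] -/
def barrierFn (i : Fin 2) (s a b : ℤ) (L M : ℕ) (z : Site 2) : ℝ :=
  dstSin L 1 (z i.rev - a) * (dstProfile L 1 (s * (z i - b)) / dstProfile L 1 (M + 1))

/-- The barrier is lattice harmonic on all of `ℤ²`. [folklore] -/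
theorem latticeLaplacian_barrierFn (i : Fin 2) {s : ℤ} (hs : s = 1 ∨ s = -1) (a b : ℤ) (L M : ℕ) (z : Site 2) :
    latticeLaplacian (barrierFn i s a b L M) z = 0 := by
  have h := latticeLaplacian_separable (fun X => dstSin L 1 (X - a))
    (fun Y => dstProfile L 1 (s * (Y - b)) / dstProfile L 1 (M + 1)) (α := Real.cos (dstAngle L 1)) (β := dstC L 1)
    (fun X => by
      have h := dstSin_rec (L := L) (m := 1) (X - a)
      rw [show X + 1 - a = X - a + 1 by ring, show X - 1 - a = X - a - 1 by ring]; exact h)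
    (fun Y => by
      have h := dstProfile_rec (L := L) (m := 1) (s * (Y - b))
      rcases hs with rfl | rfl
      · rw [show (1 : ℤ) * (Y + 1 - b) = 1 * (Y - b) + 1 by ring, show (1 : ℤ) * (Y - 1 - b) = 1 * (Y - b) - 1 by ring,
          ← add_div, h]
        ring
      · rw [show (-1 : ℤ) * (Y + 1 - b) = -1 * (Y - b) - 1 by ring, show (-1 : ℤ) * (Y - 1 - b) = -1 * (Y - b) + 1 by ring,
          ← add_div, add_comm, h]
        ring)
    (by unfold dstC; ring) i z
  exact h


/-- The universal constant of the barrier step: `c_b = (2/5) e^{-4π}`. [folklore] -/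
def barrierConst : ℝ := 2 / 5 * Real.exp (-(4 * π))

/-- `c_b > 0`. [folklore] -/
theorem barrierConst_pos : 0 < barrierConst := by unfold barrierConst; positivity

/-- `c_b ≤ 1`. [folklore] -/
theorem barrierConst_le_one : barrierConst ≤ 1 := by
  unfold barrierConst
  have : Real.exp (-(4 * π)) ≤ 1 := Real.exp_le_one_iff.2 (by have := Real.pi_pos; linarith)
  linarith

/-- On the closed rectangle `0 ≤ X ≤ L + 1`, `0 ≤ Y ≤ M + 1` the barrier takes values in `[0, 1]`. [folklore] -/
theorem barrierFn_mem_Icc (i : Fin 2) (s a b : ℤ) {L M : ℕ} (hL : 1 ≤ L) {z : Site 2}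
    (hX0 : 0 ≤ z i.rev - a) (hX1 : z i.rev - a ≤ L + 1) (hY0 : 0 ≤ s * (z i - b)) (hY1 : s * (z i - b) ≤ M + 1) :
    0 ≤ barrierFn i s a b L M z ∧ barrierFn i s a b L M z ≤ 1 := by
  unfold barrierFn
  obtain ⟨hs0, hs1⟩ := dstSin_one_mem_Icc (L := L) hX0 hX1
  have hpos : 0 < dstProfile L 1 (M + 1) := dstProfile_pos le_rfl hL (by positivity)
  set Y := s * (z i - b) with hY
  have hYnat : Y = ((Y.toNat : ℕ) : ℤ) := (Int.toNat_of_nonneg hY0).symm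
  have hr0 : 0 ≤ dstProfile L 1 Y := dstProfile_nonneg hY0
  have hr1 : dstProfile L 1 Y ≤ dstProfile L 1 (M + 1) := by
    rw [hYnat, show ((M : ℤ) + 1) = ((M + 1 : ℕ) : ℤ) by push_cast; ring]
    exact dstProfile_mono_nat (by omega)
  refine ⟨mul_nonneg hs0 (div_nonneg hr0 hpos.le), ?_⟩
  exact mul_le_one₀ hs1 (div_nonneg hr0 hpos.le) ((div_le_one hpos).2 hr1)

/-- The barrier vanishes on the three sides `X = 0`, `X = L + 1`, `Y = 0`. [folklore] -/
theorem barrierFn_eq_zero (i : Fin 2) (s a b : ℤ) (L M : ℕ) {z : Site 2}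
    (h : z i.rev - a = 0 ∨ z i.rev - a = L + 1 ∨ s * (z i - b) = 0) : barrierFn i s a b L M z = 0 := by
  unfold barrierFn
  rcases h with h | h | h
  · rw [h, dstSin_zero, zero_mul]
  · rw [h, dstSin_width, zero_mul]
  · rw [h, dstProfile_zero, zero_div, mul_zero]

/-- **The barrier is large on the good zone**: `X/(L+1) ∈ [1/4, 3/4]`, `Y ≥ (L+1)/5`, aspect
`M + 1 ≤ 4 (L + 1)` give `v ≥ c_b = (2/5) e^{-4π}`. [folklore] -/
theorem barrierConst_le_barrierFn (i : Fin 2) (s a b : ℤ) {L M : ℕ} (hL : 1 ≤ L) (hM : M + 1 ≤ 4 * (L + 1)) {z : Site 2}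
    (hX0 : ((L : ℝ) + 1) / 4 ≤ ((z i.rev - a : ℤ) : ℝ)) (hX1 : ((z i.rev - a : ℤ) : ℝ) ≤ 3 * ((L : ℝ) + 1) / 4)
    (hY : ((L : ℝ) + 1) / 5 ≤ ((s * (z i - b) : ℤ) : ℝ)) : barrierConst ≤ barrierFn i s a b L M z := by
  unfold barrierFn barrierConst
  have hs := half_le_dstSin_one (L := L) hX0 hX1
  set Y := s * (z i - b) with hYdef
  have hYpos : (0 : ℝ) < (Y : ℝ) := lt_of_lt_of_le (by positivity) hY
  have hY0 : 0 ≤ Y := by exact_mod_cast hYpos.le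
  have hYnat : Y = ((Y.toNat : ℕ) : ℤ) := (Int.toNat_of_nonneg hY0).symm
  have hr : 4 / 5 * Real.exp (-(4 * π)) ≤ dstProfile L 1 Y / dstProfile L 1 (M + 1) := by
    rw [hYnat]
    refine le_dstProfile_ratio hL hM ?_
    have : ((Y.toNat : ℕ) : ℝ) = ((Y : ℤ) : ℝ) := by conv_rhs => rw [hYnat, Int.cast_natCast]
    rw [this]; exact hY
  have h0 : 0 ≤ 4 / 5 * Real.exp (-(4 * π)) := by positivity
  calc 2 / 5 * Real.exp (-(4 * π)) = 1 / 2 * (4 / 5 * Real.exp (-(4 * π))) := by ring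
    _ ≤ dstSin L 1 (z i.rev - a) * (dstProfile L 1 Y / dstProfile L 1 (M + 1)) :=
        mul_le_mul hs hr h0 (le_trans (by norm_num) hs)

/-- Frame coordinates along an adjacency: `(X, Y)` moves by a unit vector. [folklore] -/
theorem frame_coords_of_adj (i : Fin 2) {s : ℤ} (hs : s = 1 ∨ s = -1) (a b : ℤ) {v w : Site 2} (h : (zdGraph 2).Adj v w) :
    (w i.rev - a = v i.rev - a + 1 ∧ s * (w i - b) = s * (v i - b)) ∨
    (w i.rev - a = v i.rev - a - 1 ∧ s * (w i - b) = s * (v i - b)) ∨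
    (w i.rev - a = v i.rev - a ∧ s * (w i - b) = s * (v i - b) + 1) ∨
    (w i.rev - a = v i.rev - a ∧ s * (w i - b) = s * (v i - b) - 1) := by
  have hc := coord_step_of_adj h
  fin_cases i <;> simp only [Fin.zero_eta, Fin.mk_one, rev_zero_fin_two, rev_one_fin_two] <;>
    rcases hs with rfl | rfl <;> omega

/-- **The barrier step.** Let `D` lie in the rectangle `1 ≤ X ≤ L`, `1 ≤ Y ≤ M` of the frame
`(i, s, a, b)` (`L ≥ 1`, `M + 1 ≤ 4 (L + 1)`), let `ψ` be superharmonic on `D`, nonnegative on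
`∂D`, and `≥ γ` at the points of `∂D` inside the rectangle or on its far side `Y = M + 1`. Then
`ψ ≥ γ c_b` on the good zone of `D` (comparison with `γ ·` barrier). [folklore] -/
theorem barrier_step (i : Fin 2) {s : ℤ} (hs : s = 1 ∨ s = -1) (a b : ℤ) {L M : ℕ} (hL : 1 ≤ L) (hM : M + 1 ≤ 4 * (L + 1))
    {D : Set (Site 2)} (hDfin : D.Finite)
    (hD : ∀ z ∈ D, 1 ≤ z i.rev - a ∧ z i.rev - a ≤ L ∧ 1 ≤ s * (z i - b) ∧ s * (z i - b) ≤ M)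
    {ψ : Site 2 → ℝ} (hψ : IsLatticeSuperharmonicOn ψ D) {γ : ℝ} (hγ : 0 ≤ γ)
    (h0 : ∀ w ∈ latticeOuterBoundary D, 0 ≤ ψ w)
    (h1 : ∀ w ∈ latticeOuterBoundary D, 1 ≤ w i.rev - a → w i.rev - a ≤ L → 1 ≤ s * (w i - b) → s * (w i - b) ≤ M + 1 → γ ≤ ψ w)
    {z : Site 2} (hz : z ∈ D)
    (hX0 : ((L : ℝ) + 1) / 4 ≤ ((z i.rev - a : ℤ) : ℝ)) (hX1 : ((z i.rev - a : ℤ) : ℝ) ≤ 3 * ((L : ℝ) + 1) / 4)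
    (hY : ((L : ℝ) + 1) / 5 ≤ ((s * (z i - b) : ℤ) : ℝ)) : γ * barrierConst ≤ ψ z := by
  set v := barrierFn i s a b L M with hv
  have hsub : IsLatticeSubharmonicOn (fun x => γ * v x) D := fun x _ => by
    rw [latticeLaplacian_const_mul, hv, latticeLaplacian_barrierFn i hs]; simp
  have hb : ∀ w ∈ latticeOuterBoundary D, (fun x => γ * v x) w ≤ ψ w + 0 := by
    intro w hw
    rw [add_zero]
    obtain ⟨-, u, hu, hadj⟩ := mem_latticeOuterBoundary_iff.1 hw
    obtain ⟨hu1, hu2, hu3, hu4⟩ := hD u hu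
    have hc := frame_coords_of_adj i hs a b hadj
    by_cases hzero : w i.rev - a = 0 ∨ w i.rev - a = L + 1 ∨ s * (w i - b) = 0
    · show γ * v w ≤ ψ w
      rw [hv, barrierFn_eq_zero i s a b L M hzero, mul_zero]
      exact h0 w hw
    · push Not at hzero
      have hin : 1 ≤ w i.rev - a ∧ w i.rev - a ≤ L ∧ 1 ≤ s * (w i - b) ∧ s * (w i - b) ≤ M + 1 := by omega
      have hle : v w ≤ 1 := (barrierFn_mem_Icc i s a b hL (by omega) (by omega) (by omega) hin.2.2.2).2
      show γ * v w ≤ ψ w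
      calc γ * v w ≤ γ * 1 := by gcongr
        _ = γ := mul_one γ
        _ ≤ ψ w := h1 w hw hin.1 hin.2.1 hin.2.2.1 hin.2.2.2
  have key := le_of_sub_super_of_boundary hDfin hsub hψ hb z hz
  rw [add_zero] at key
  calc γ * barrierConst ≤ γ * v z := by
        gcongr
        exact barrierConst_le_barrierFn i s a b hL hM hX0 hX1 hY
    _ ≤ ψ z := key


/-! ### §4. The escape function of a scale and its lower bound near the centre

For a scale with outer radius `m` put `T = S ∩ sqBox p m` and let `ψ` (`escapeFn S p m`) be the
lattice-harmonic function on `T` with boundary data `1` off `S` and `0` on `S ∖ sqBox p m`: in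
random-walk language, the probability to hit `∂S` before leaving the box. A harmonic `h` on `S`
vanishing on `∂S` near `p` and bounded by `M₀` on `S ∩ sqBox p (m+1)` satisfies
`h ≤ M₀ (1 - ψ)` on `T`; the heart of the matter is `ψ ≥ c_b²` on `S ∩ sqBox p n` for
`m = 4n - 1` when one strip of the annulus is blocked (§2): the barrier step on the
`S ∩ strip`-component of a point of the middle zone of the blocked strip (whose boundary inside
the strip lies off `S`, where `ψ = 1`) and then on an approach rectangle from `sqBox p n` to that
zone. -/

/-- The sites of `S` in the box of radius `m`: the domain of the escape function. [folklore] -/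
def scaleDom (S : Set (Site 2)) (p : Site 2) (m : ℤ) : Set (Site 2) := S ∩ sqBox p m

/-- `scaleDom` is finite. [folklore] -/
theorem scaleDom_finite (S : Set (Site 2)) (p : Site 2) (m : ℤ) : (scaleDom S p m).Finite :=
  (sqBox_finite p m).subset Set.inter_subset_right

/-- Existence of the escape function (the discrete Dirichlet problem on `scaleDom`). [folklore] -/
theorem exists_escapeFn (S : Set (Site 2)) (p : Site 2) (m : ℤ) :
    ∃ u : Site 2 → ℝ, IsLatticeHarmonicOn u (scaleDom S p m) ∧ ∀ w ∉ scaleDom S p m, u w = Sᶜ.indicator (fun _ => (1 : ℝ)) w :=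
  exists_isLatticeHarmonicOn_eq_off (scaleDom_finite S p m) _

/-- **The escape function** of the scale of outer radius `m`: harmonic on `S ∩ sqBox p m`, equal to
`1` off `S` and to `0` on `S` outside the box. [folklore] -/
def escapeFn (S : Set (Site 2)) (p : Site 2) (m : ℤ) : Site 2 → ℝ := (exists_escapeFn S p m).choose

/-- The escape function is harmonic on the scale domain. [folklore] -/
theorem escapeFn_harmonicOn (S : Set (Site 2)) (p : Site 2) (m : ℤ) : IsLatticeHarmonicOn (escapeFn S p m) (scaleDom S p m) :=
  (exists_escapeFn S p m).choose_spec.1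

/-- Off `S` the escape function equals `1`. [folklore] -/
theorem escapeFn_of_not_mem {S : Set (Site 2)} (p : Site 2) (m : ℤ) {w : Site 2} (hw : w ∉ S) : escapeFn S p m w = 1 := by
  have h := (exists_escapeFn S p m).choose_spec.2 w (fun h => hw h.1)
  rw [Set.indicator_of_mem (Set.mem_compl hw)] at h
  exact h

/-- On `S` outside the box the escape function equals `0`. [folklore] -/
theorem escapeFn_of_mem_of_not_mem_sqBox {S : Set (Site 2)} {p : Site 2} {m : ℤ} {w : Site 2} (hw : w ∈ S) (hw' : w ∉ sqBox p m) :
    escapeFn S p m w = 0 := by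
  have h := (exists_escapeFn S p m).choose_spec.2 w (fun h => hw' h.2)
  rw [Set.indicator_of_notMem (Set.notMem_compl_iff.2 hw)] at h
  exact h

/-- Off the scale domain the escape function takes values in `{0, 1}`, in particular in `[0, 1]`. [folklore] -/
theorem escapeFn_mem_Icc_of_not_mem {S : Set (Site 2)} {p : Site 2} {m : ℤ} {w : Site 2} (hw : w ∉ scaleDom S p m) :
    0 ≤ escapeFn S p m w ∧ escapeFn S p m w ≤ 1 := by
  by_cases hS : w ∈ S
  · have : w ∉ sqBox p m := fun h => hw ⟨hS, h⟩
    rw [escapeFn_of_mem_of_not_mem_sqBox hS this]; exact ⟨le_rfl, zero_le_one⟩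
  · rw [escapeFn_of_not_mem p m hS]; exact ⟨zero_le_one, le_rfl⟩

/-- **`0 ≤ ψ ≤ 1` everywhere** (maximum principle on the scale domain, boundary data in `{0, 1}`). [folklore] -/
theorem escapeFn_mem_Icc (S : Set (Site 2)) (p : Site 2) (m : ℤ) (w : Site 2) : 0 ≤ escapeFn S p m w ∧ escapeFn S p m w ≤ 1 := by
  by_cases hw : w ∈ scaleDom S p m
  · have hb : ∀ u ∈ latticeOuterBoundary (scaleDom S p m), 0 ≤ escapeFn S p m u ∧ escapeFn S p m u ≤ 1 :=
      fun u hu => escapeFn_mem_Icc_of_not_mem hu.1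
    exact ⟨(escapeFn_harmonicOn S p m).superharmonicOn.ge_of_forall_boundary_ge (scaleDom_finite S p m)
        (fun u hu => (hb u hu).1) w hw,
      (escapeFn_harmonicOn S p m).subharmonicOn.le_of_forall_boundary_le (scaleDom_finite S p m)
        (fun u hu => (hb u hu).2) w hw⟩
  · exact escapeFn_mem_Icc_of_not_mem hw

/-- `c_b ≤ ψ` off `S` (where `ψ = 1`). [folklore] -/
theorem barrierConst_le_escapeFn_of_not_mem {S : Set (Site 2)} (p : Site 2) (m : ℤ) {w : Site 2} (hw : w ∉ S) :
    barrierConst ≤ escapeFn S p m w := by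
  rw [escapeFn_of_not_mem p m hw]; exact barrierConst_le_one

/-- **Domination of `h` by the escape function.** If `h` is harmonic on `S`, vanishes on the outer
boundary of `S` inside `sqBox p (m + 1)` and is `≤ M₀` on `S ∩ sqBox p (m + 1)`, then
`h ≤ M₀ (1 - ψ)` on `S ∩ sqBox p m` (comparison principle). [folklore] -/
theorem le_mul_one_sub_escapeFn {S : Set (Site 2)} {p : Site 2} {m : ℤ} {h : Site 2 → ℝ} (hh : IsLatticeHarmonicOn h S)
    (h0 : ∀ w ∈ latticeOuterBoundary S, w ∈ sqBox p (m + 1) → h w = 0) {M₀ : ℝ}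
    (hle : ∀ w ∈ S, w ∈ sqBox p (m + 1) → h w ≤ M₀) :
    ∀ v ∈ scaleDom S p m, h v ≤ M₀ * (1 - escapeFn S p m v) := by
  have hsub : IsLatticeSubharmonicOn h (scaleDom S p m) := fun v hv => (hh v hv.1).ge
  have hsup : IsLatticeSuperharmonicOn (fun v => M₀ * (1 - escapeFn S p m v)) (scaleDom S p m) := fun v hv => by
    have h1 : latticeLaplacian (fun v => M₀ * (1 - escapeFn S p m v)) v =
        M₀ * latticeLaplacian (fun v => 1 - escapeFn S p m v) v :=
      latticeLaplacian_const_mul M₀ (fun v => 1 - escapeFn S p m v) v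
    have h2 : latticeLaplacian (fun v => (1 : ℝ) - escapeFn S p m v) v =
        latticeLaplacian (fun _ => (1 : ℝ)) v - latticeLaplacian (escapeFn S p m) v :=
      latticeLaplacian_sub (fun _ => (1 : ℝ)) (escapeFn S p m) v
    show latticeLaplacian (fun v => M₀ * (1 - escapeFn S p m v)) v ≤ 0
    rw [h1, h2, latticeLaplacian_const, escapeFn_harmonicOn S p m v hv]
    simp
  intro v hv
  have key := le_of_sub_super_of_boundary (scaleDom_finite S p m) hsub hsup (c := 0) ?_ v hv
  · simpa using key
  intro w hw
  rw [add_zero]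
  obtain ⟨hwT, u, hu, hadj⟩ := mem_latticeOuterBoundary_iff.1 hw
  have hwbox : w ∈ sqBox p (m + 1) := mem_sqBox_succ_of_adj hu.2 hadj
  by_cases hwS : w ∈ S
  · have hwm : w ∉ sqBox p m := fun h' => hwT ⟨hwS, h'⟩
    rw [escapeFn_of_mem_of_not_mem_sqBox hwS hwm]
    simpa using hle w hwS hwbox
  · rw [escapeFn_of_not_mem p m hwS, h0 w (mem_latticeOuterBoundary_of_adj hu.1 hwS hadj) hwbox]
    simp


/-- Box membership in the coordinates `i`, `i.rev`. [folklore] -/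
theorem mem_sqBox_iff_frame (i : Fin 2) {p z : Site 2} {r : ℤ} :
    z ∈ sqBox p r ↔ |z i - p i| ≤ r ∧ |z i.rev - p i.rev| ≤ r := by
  rw [mem_sqBox]
  fin_cases i
  · simp
  · simp only [Fin.mk_one, rev_one_fin_two]; exact and_comm

/-- The **`S ∩ U`-component** of `y`: points joined to `y` by a lattice walk inside `S ∩ U`. [folklore] -/
def compSet (S U : Set (Site 2)) (y : Site 2) : Set (Site 2) :=
  {z | ∃ P : (zdGraph 2).Walk y z, ∀ w ∈ P.support, w ∈ S ∧ w ∈ U}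

/-- The component lies in `S ∩ U`. [folklore] -/
theorem compSet_subset {S U : Set (Site 2)} {y z : Site 2} (hz : z ∈ compSet S U y) : z ∈ S ∧ z ∈ U := by
  obtain ⟨P, hP⟩ := hz
  exact hP z (Walk.end_mem_support P)

/-- `y` lies in its own component. [folklore] -/
theorem mem_compSet_self {S U : Set (Site 2)} {y : Site 2} (hy : y ∈ S ∧ y ∈ U) : y ∈ compSet S U y :=
  ⟨Walk.nil, fun w hw => by rw [Walk.support_nil, List.mem_singleton] at hw; subst hw; exact hy⟩

/-- The component is closed under adjacency inside `S ∩ U`. [folklore] -/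
theorem mem_compSet_of_adj {S U : Set (Site 2)} {y u w : Site 2} (hu : u ∈ compSet S U y) (hadj : (zdGraph 2).Adj u w)
    (hw : w ∈ S ∧ w ∈ U) : w ∈ compSet S U y := by
  obtain ⟨P, hP⟩ := hu
  refine ⟨P.append (Walk.cons hadj Walk.nil), fun x hx => ?_⟩
  rw [Walk.mem_support_append_iff, Walk.support_cons, Walk.support_nil, List.mem_cons, List.mem_singleton] at hx
  rcases hx with hx | rfl | rfl
  · exact hP x hx
  · exact hP _ (Walk.end_mem_support P)
  · exact hw

/-- The component is finite when `U` lies in a box. [folklore] -/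
theorem compSet_finite {S U : Set (Site 2)} {y p : Site 2} {r : ℤ} (hU : U ⊆ sqBox p r) : (compSet S U y).Finite :=
  (sqBox_finite p r).subset fun _ hz => hU (compSet_subset hz).2

/-- If the component of `y` in `S ∩ strip` touches both short sides of the strip, the strip has a
long crossing inside `S`. [folklore] -/
theorem hasLongCrossing_of_compSet {S : Set (Site 2)} {p y : Site 2} {i : Fin 2} {s n m : ℤ}
    {l r : Site 2} (hl : l ∈ compSet S (strip p i s n m) y) (hr : r ∈ compSet S (strip p i s n m) y)
    (hli : l i.rev = p i.rev - m) (hri : r i.rev = p i.rev + m) : HasLongCrossing S p i s n m := by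
  obtain ⟨Pl, hPl⟩ := hl
  obtain ⟨Pr, hPr⟩ := hr
  refine ⟨l, r, Pl.reverse.append Pr, hli, hri, fun z hz => ?_⟩
  rw [Walk.mem_support_append_iff, Walk.support_reverse, List.mem_reverse] at hz
  rcases hz with hz | hz
  · exact hPl z hz
  · exact hPr z hz

variable {S : Set (Site 2)} {p : Site 2} {n : ℕ}

/-- **The component bound.** In the strip `U = strip p i s n (4n)` with tangential offset `a'`
(`X = z_i - a' ∈ [1, 3n]` on `U`), if the `S ∩ U`-component of `y ∈ S ∩ U` misses the short side
`z_{i.rev} = p_{i.rev} + s' · 4n`, then `ψ(y) ≥ c_b` for `y` in the middle zone: the barrier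
step toward that side on the component, whose outer boundary inside the closed strip lies off `S`
(where `ψ = 1`). [folklore] -/
theorem barrierConst_le_escapeFn_of_compSet (hn : 1 ≤ n) (i : Fin 2) {s : ℤ} (hs : s = 1 ∨ s = -1) {s' : ℤ} (hs' : s' = 1 ∨ s' = -1)
    (a' : ℤ) (hUa : ∀ z : Site 2, (((n : ℤ) + 1 ≤ s * (z i - p i) ∧ s * (z i - p i) ≤ 4 * n) ↔ (1 ≤ z i - a' ∧ z i - a' ≤ 3 * n)))
    {y : Site 2} (hy : y ∈ S ∧ y ∈ strip p i s n (4 * n))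
    (hmiss : ∀ u ∈ compSet S (strip p i s n (4 * n)) y, u i.rev ≠ p i.rev + s' * (4 * n))
    (hX0 : ((3 * n : ℕ) + 1 : ℝ) / 4 ≤ ((y i - a' : ℤ) : ℝ)) (hX1 : ((y i - a' : ℤ) : ℝ) ≤ 3 * ((3 * n : ℕ) + 1 : ℝ) / 4)
    (hyt : |y i.rev - p i.rev| ≤ 2 * n) :
    barrierConst ≤ escapeFn S p (4 * n) y := by
  set U := strip p i s n (4 * n) with hUdef
  set A := compSet S U y with hAdef
  have hAU : ∀ z ∈ A, z ∈ S ∧ z ∈ U := fun z hz => compSet_subset hz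
  have hUbox : U ⊆ sqBox p (4 * n) := strip_subset_sqBox hs (by positivity)
  have hAfin : A.Finite := compSet_finite hUbox
  have hAT : A ⊆ scaleDom S p (4 * n) := fun z hz => ⟨(hAU z hz).1, hUbox (hAU z hz).2⟩
  -- frame data of the points of `U`
  have hUcoord : ∀ z ∈ U, (1 ≤ z i - a' ∧ z i - a' ≤ 3 * n) ∧ |z i.rev - p i.rev| ≤ 4 * n := fun z hz => by
    rw [hUdef, mem_strip] at hz
    exact ⟨(hUa z).1 ⟨hz.1, hz.2.1⟩, hz.2.2⟩
  have key := barrier_step i.rev hs' a' (p i.rev - s' * (4 * n + 1)) (L := 3 * n) (M := 8 * n + 1) (by omega) (by omega)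
    hAfin (D := A) (ψ := escapeFn S p (4 * n)) (γ := 1) ?_ ?_ zero_le_one ?_ ?_ (z := y) (mem_compSet_self hy) ?_ ?_ ?_
  · simpa using key
  · -- `A` lies in the rectangle of the frame
    intro z hz
    obtain ⟨⟨h1, h2⟩, h3⟩ := hUcoord z (hAU z hz).2
    rw [Fin.rev_rev]
    rw [abs_le] at h3
    refine ⟨h1, by push_cast; exact h2, ?_, ?_⟩ <;> rcases hs' with rfl | rfl <;> push_cast <;> nlinarith
  · exact fun z hz => ((escapeFn_harmonicOn S p (4 * n)) z (hAT hz)).le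
  · exact fun w _ => (escapeFn_mem_Icc S p (4 * n) w).1
  · -- boundary points inside the closed rectangle are off `S`
    intro w hw hX1w hX2w hY1w hY2w
    rw [Fin.rev_rev] at hX1w hX2w
    by_cases hwS : w ∈ S
    · exfalso
      obtain ⟨hwA, u, hu, hadj⟩ := mem_latticeOuterBoundary_iff.1 hw
      have hwU : w ∉ U := fun h => hwA (mem_compSet_of_adj hu hadj ⟨hwS, h⟩)
      rw [hUdef, mem_strip] at hwU
      have hnorm := (hUa w).2 ⟨hX1w, by exact_mod_cast hX2w⟩
      have hwt : ¬ |w i.rev - p i.rev| ≤ 4 * n := fun h => hwU ⟨hnorm.1, hnorm.2, h⟩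
      rw [abs_le, not_and_or, not_le, not_le] at hwt
      obtain ⟨-, hut⟩ := hUcoord u (hAU u hu).2
      rw [abs_le] at hut
      have hstep := coord_step_of_adj hadj
      have hmu := hmiss u hu
      push_cast at hY1w hY2w
      fin_cases i <;> simp only [Fin.zero_eta, Fin.mk_one, rev_zero_fin_two, rev_one_fin_two] at hwt hut hmu hY1w hY2w <;>
        rcases hs' with rfl | rfl <;> omega
    · rw [escapeFn_of_not_mem p (4 * n) hwS]
  · rw [Fin.rev_rev]; exact hX0
  · rw [Fin.rev_rev]; exact hX1
  · rw [abs_le] at hyt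
    have h1 : (2 : ℤ) * n + 1 ≤ s' * (y i.rev - (p i.rev - s' * (4 * n + 1))) := by
      rcases hs' with rfl | rfl <;> nlinarith
    have h2 : ((2 : ℤ) * n + 1 : ℝ) ≤ ((s' * (y i.rev - (p i.rev - s' * (4 * n + 1))) : ℤ) : ℝ) := by exact_mod_cast h1
    refine le_trans ?_ h2
    push_cast
    linarith


/-- **The zone bound.** If the strip `(i, s)` of the annulus `sqBox p (4n) ∖ sqBox p n` has no
long crossing inside `S`, then `ψ ≥ c_b` on its middle zone
`{|z_{i.rev} - p_{i.rev}| ≤ 2n, X/(3n+1) ∈ [1/4, 3/4]}` (off `S` because `ψ = 1` there; on `S` by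
the component bound toward the short side the component misses). [folklore] -/
theorem barrierConst_le_escapeFn_of_zone (hn : 1 ≤ n) (i : Fin 2) {s : ℤ} (hs : s = 1 ∨ s = -1) (a' : ℤ)
    (hUa : ∀ z : Site 2, (((n : ℤ) + 1 ≤ s * (z i - p i) ∧ s * (z i - p i) ≤ 4 * n) ↔ (1 ≤ z i - a' ∧ z i - a' ≤ 3 * n)))
    (hblock : ¬ HasLongCrossing S p i s n (4 * n)) {y : Site 2}
    (hX0 : ((3 * n : ℕ) + 1 : ℝ) / 4 ≤ ((y i - a' : ℤ) : ℝ)) (hX1 : ((y i - a' : ℤ) : ℝ) ≤ 3 * ((3 * n : ℕ) + 1 : ℝ) / 4)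
    (hyt : |y i.rev - p i.rev| ≤ 2 * n) : barrierConst ≤ escapeFn S p (4 * n) y := by
  by_cases hyS : y ∈ S
  · have hn1 : (1 : ℝ) ≤ n := by exact_mod_cast hn
    have hXlo : (0 : ℝ) < ((y i - a' : ℤ) : ℝ) := lt_of_lt_of_le (by positivity) hX0
    have hXhi : ((y i - a' : ℤ) : ℝ) ≤ ((3 * n : ℕ) : ℝ) := by
      refine hX1.trans ?_
      push_cast; linarith
    have hX : 1 ≤ y i - a' ∧ y i - a' ≤ 3 * n := by
      constructor
      · have : (0 : ℤ) < y i - a' := by exact_mod_cast hXlo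
        omega
      · exact_mod_cast hXhi
    have hyU : y ∈ strip p i s n (4 * n) := by
      rw [mem_strip]
      obtain ⟨h1, h2⟩ := (hUa y).2 hX
      rw [abs_le] at hyt
      exact ⟨h1, h2, by rw [abs_le]; constructor <;> linarith⟩
    by_cases hr : ∃ u ∈ compSet S (strip p i s n (4 * n)) y, u i.rev = p i.rev + 4 * n
    · by_cases hl : ∃ u ∈ compSet S (strip p i s n (4 * n)) y, u i.rev = p i.rev - 4 * n
      · obtain ⟨r, hr, hri⟩ := hr
        obtain ⟨l, hl, hli⟩ := hl
        exact absurd (hasLongCrossing_of_compSet hl hr hli hri) hblock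
      · push Not at hl
        exact barrierConst_le_escapeFn_of_compSet hn i hs (Or.inr rfl) a' hUa ⟨hyS, hyU⟩
          (fun u hu h => hl u hu (by linarith)) hX0 hX1 hyt
    · push Not at hr
      exact barrierConst_le_escapeFn_of_compSet hn i hs (Or.inl rfl) a' hUa ⟨hyS, hyU⟩
        (fun u hu h => hr u hu (by linarith)) hX0 hX1 hyt
  · exact barrierConst_le_escapeFn_of_not_mem p _ hyS

/-- **The approach step.** With the strip `(i, s)` blocked, `ψ ≥ c_b²` on `S ∩ sqBox p n`: the
barrier step on the approach rectangle (tangential range `|z_{i.rev} - p_{i.rev}| ≤ 2n`, normal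
range `-2n ≤ s (z_i - p_i) ≤ 2n - 1`, far side `s (z_i - p_i) = 2n` inside the middle zone)
intersected with `S`. [folklore] -/
theorem sq_barrierConst_le_escapeFn (hn : 1 ≤ n) (i : Fin 2) {s : ℤ} (hs : s = 1 ∨ s = -1) (a' : ℤ)
    (hUa : ∀ z : Site 2, (((n : ℤ) + 1 ≤ s * (z i - p i) ∧ s * (z i - p i) ≤ 4 * n) ↔ (1 ≤ z i - a' ∧ z i - a' ≤ 3 * n)))
    (ha : (s = 1 ∧ a' = p i + n) ∨ (s = -1 ∧ a' = p i - 4 * n - 1))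
    (hblock : ¬ HasLongCrossing S p i s n (4 * n)) {z : Site 2} (hzS : z ∈ S) (hz : z ∈ sqBox p n) :
    barrierConst * barrierConst ≤ escapeFn S p (4 * n) z := by
  obtain ⟨a, ha0⟩ : ∃ a : ℤ, a = p i.rev - 2 * n - 1 := ⟨_, rfl⟩
  obtain ⟨b, hb0⟩ : ∃ b : ℤ, b = p i - s * (2 * n + 1) := ⟨_, rfl⟩
  have hss : s * s = 1 := by rcases hs with rfl | rfl <;> norm_num
  -- frame coordinates: `X = z_{i.rev} - a = z_{i.rev} - p_{i.rev} + 2n + 1`, `Y = s (z_i - b) = s (z_i - p_i) + 2n + 1`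
  have hY : ∀ w : Site 2, s * (w i - b) = s * (w i - p i) + 2 * n + 1 := fun w => by
    rw [hb0]; linear_combination (2 * (n : ℤ) + 1) * hss
  set R : Set (Site 2) := {w | 1 ≤ w i.rev - a ∧ w i.rev - a ≤ ((4 * n + 1 : ℕ) : ℤ) ∧ 1 ≤ s * (w i - b) ∧ s * (w i - b) ≤ ((4 * n : ℕ) : ℤ)}
    with hRdef
  have hRbox : R ⊆ sqBox p (4 * n) := fun w hw => by
    obtain ⟨h1, h2, h3, h4⟩ := hw
    rw [mem_sqBox_iff_frame i, abs_le, abs_le]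
    push_cast at h2 h4
    rw [hY w] at h3 h4
    refine ⟨⟨?_, ?_⟩, ?_, ?_⟩ <;> rcases hs with rfl | rfl <;> omega
  set D : Set (Site 2) := R ∩ S with hDdef
  have hDfin : D.Finite := (sqBox_finite p (4 * n)).subset fun w hw => hRbox hw.1
  have hDT : D ⊆ scaleDom S p (4 * n) := fun w hw => ⟨hw.2, hRbox hw.1⟩
  have hzc := (mem_sqBox_iff_frame i).1 hz
  rw [abs_le, abs_le] at hzc
  have hzR : z ∈ R := by
    refine ⟨by omega, by push_cast; omega, ?_, ?_⟩ <;> rw [hY z] <;> rcases hs with rfl | rfl <;> push_cast <;> omega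
  have hn1 : (1 : ℝ) ≤ n := by exact_mod_cast hn
  have hzt1 : (-(n : ℝ)) ≤ ((z i.rev : ℤ) : ℝ) - ((p i.rev : ℤ) : ℝ) := by exact_mod_cast hzc.2.1
  have hzt2 : ((z i.rev : ℤ) : ℝ) - ((p i.rev : ℤ) : ℝ) ≤ (n : ℝ) := by exact_mod_cast hzc.2.2
  refine barrier_step i hs a b (L := 4 * n + 1) (M := 4 * n) (by omega) (by omega) hDfin (D := D)
    (ψ := escapeFn S p (4 * n)) (γ := barrierConst) (fun w hw => hw.1)
    (fun w hw => ((escapeFn_harmonicOn S p (4 * n)) w (hDT hw)).le) barrierConst_pos.le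
    (fun w _ => (escapeFn_mem_Icc S p (4 * n) w).1) ?_ (z := z) ⟨hzR, hzS⟩ ?_ ?_ ?_
  · -- boundary values: inside the rectangle `ψ = 1` (off `S`); on the far side the zone bound
    intro w hw hX1w hX2w hY1w hY2w
    by_cases hwS : w ∈ S
    · have hwR : w ∉ R := fun h => hw.1 ⟨h, hwS⟩
      have hYw : s * (w i - b) = 4 * n + 1 := by
        by_contra hne
        push_cast at hY2w
        exact hwR ⟨hX1w, hX2w, hY1w, by push_cast; omega⟩
      rw [hY w] at hYw
      refine barrierConst_le_escapeFn_of_zone hn i hs a' hUa hblock ?_ ?_ ?_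
      · rcases ha with ⟨rfl, rfl⟩ | ⟨rfl, rfl⟩
        · have e : w i - (p i + n) = n := by omega
          rw [e]; push_cast; linarith
        · have e : w i - (p i - 4 * n - 1) = 2 * n + 1 := by omega
          rw [e]; push_cast; linarith
      · rcases ha with ⟨rfl, rfl⟩ | ⟨rfl, rfl⟩
        · have e : w i - (p i + n) = n := by omega
          rw [e]; push_cast; linarith
        · have e : w i - (p i - 4 * n - 1) = 2 * n + 1 := by omega
          rw [e]; push_cast; linarith
      · push_cast at hX2w
        rw [abs_le]; constructor <;> omega
    · exact barrierConst_le_escapeFn_of_not_mem p _ hwS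
  · have e : z i.rev - a = z i.rev - p i.rev + 2 * n + 1 := by omega
    rw [e]; push_cast; linarith
  · have e : z i.rev - a = z i.rev - p i.rev + 2 * n + 1 := by omega
    rw [e]; push_cast; linarith
  · rw [hY z]
    have h1 : (n : ℤ) + 1 ≤ s * (z i - p i) + 2 * n + 1 := by rcases hs with rfl | rfl <;> omega
    have h2 : ((n : ℝ) + 1) ≤ ((s * (z i - p i) + 2 * n + 1 : ℤ) : ℝ) := by exact_mod_cast h1
    refine le_trans ?_ h2
    push_cast; linarith

/-- **One scale.** If `S` does not contain long crossings of all four strips of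
`sqBox p (4n) ∖ sqBox p n`, then the escape function of radius `4n` is at least `c_b²` on
`S ∩ sqBox p n`. [folklore] -/
theorem sq_barrierConst_le_escapeFn_of_not_all (hn : 1 ≤ n)
    (hnot : ¬ (HasLongCrossing S p 1 1 n (4 * n) ∧ HasLongCrossing S p 1 (-1) n (4 * n) ∧
        HasLongCrossing S p 0 1 n (4 * n) ∧ HasLongCrossing S p 0 (-1) n (4 * n)))
    {z : Site 2} (hzS : z ∈ S) (hz : z ∈ sqBox p n) : barrierConst * barrierConst ≤ escapeFn S p (4 * n) z := by
  have hU1 : ∀ (i : Fin 2) (z : Site 2), (((n : ℤ) + 1 ≤ 1 * (z i - p i) ∧ 1 * (z i - p i) ≤ 4 * n) ↔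
      (1 ≤ z i - (p i + n) ∧ z i - (p i + n) ≤ 3 * n)) := fun i z => by omega
  have hU2 : ∀ (i : Fin 2) (z : Site 2), (((n : ℤ) + 1 ≤ -1 * (z i - p i) ∧ -1 * (z i - p i) ≤ 4 * n) ↔
      (1 ≤ z i - (p i - 4 * n - 1) ∧ z i - (p i - 4 * n - 1) ≤ 3 * n)) := fun i z => by omega
  simp only [not_and_or] at hnot
  rcases hnot with h | h | h | h
  · exact sq_barrierConst_le_escapeFn hn 1 (Or.inl rfl) _ (hU1 1) (Or.inl ⟨rfl, rfl⟩) h hzS hz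
  · exact sq_barrierConst_le_escapeFn hn 1 (Or.inr rfl) _ (hU2 1) (Or.inr ⟨rfl, rfl⟩) h hzS hz
  · exact sq_barrierConst_le_escapeFn hn 0 (Or.inl rfl) _ (hU1 0) (Or.inl ⟨rfl, rfl⟩) h hzS hz
  · exact sq_barrierConst_le_escapeFn hn 0 (Or.inr rfl) _ (hU2 0) (Or.inr ⟨rfl, rfl⟩) h hzS hz


/-! ### §5. Iteration over `4`-adic scales -/

/-- The contraction factor of one scale: `θ = 1 - c_b²`. [folklore] -/
def scaleTheta : ℝ := 1 - barrierConst * barrierConst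

/-- `0 < θ`. [folklore] -/
theorem scaleTheta_pos : 0 < scaleTheta := by
  unfold scaleTheta
  have h1 := barrierConst_le_one
  have h2 : barrierConst ≤ 2 / 5 := by
    unfold barrierConst
    have : Real.exp (-(4 * π)) ≤ 1 := Real.exp_le_one_iff.2 (by have := Real.pi_pos; linarith)
    linarith
  have h0 := barrierConst_pos
  nlinarith

/-- `θ < 1`. [folklore] -/
theorem scaleTheta_lt_one : scaleTheta < 1 := by
  unfold scaleTheta
  have h0 := barrierConst_pos
  nlinarith

/-- **One scale for `h`.** If `h` is harmonic on `S`, vanishes on `∂S ∩ sqBox p (4n+1)`, is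
`≤ M₀` (`M₀ ≥ 0`) on `S ∩ sqBox p (4n+1)`, and `S` has a blocked strip at scale `n`, then
`h ≤ θ M₀` on `S ∩ sqBox p n`. [folklore] -/
theorem scale_step (hn : 1 ≤ n) {h : Site 2 → ℝ} (hh : IsLatticeHarmonicOn h S)
    (h0 : ∀ w ∈ latticeOuterBoundary S, w ∈ sqBox p (4 * n + 1) → h w = 0)
    (hnot : ¬ (HasLongCrossing S p 1 1 n (4 * n) ∧ HasLongCrossing S p 1 (-1) n (4 * n) ∧
        HasLongCrossing S p 0 1 n (4 * n) ∧ HasLongCrossing S p 0 (-1) n (4 * n)))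
    {M₀ : ℝ} (hM₀ : 0 ≤ M₀) (hle : ∀ w ∈ S, w ∈ sqBox p (4 * n + 1) → h w ≤ M₀)
    {v : Site 2} (hvS : v ∈ S) (hv : v ∈ sqBox p n) : h v ≤ scaleTheta * M₀ := by
  have hvT : v ∈ scaleDom S p (4 * n) := ⟨hvS, sqBox_mono p (by omega) hv⟩
  have h1 := le_mul_one_sub_escapeFn (m := 4 * n) hh h0 hle v hvT
  have h2 := sq_barrierConst_le_escapeFn_of_not_all hn hnot hvS hv
  unfold scaleTheta
  nlinarith

/-- The radii of the nested scales: `r₀(n) = n`, `r_{j+1}(n) = r_j(4n + 1)`. [folklore] -/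
def scaleRad : ℕ → ℕ → ℕ
  | 0, n => n
  | j + 1, n => scaleRad j (4 * n + 1)

/-- Closed form: `3 r_j(n) + 1 = 4^j (3n + 1)`. [folklore] -/
theorem three_mul_scaleRad (j n : ℕ) : 3 * scaleRad j n + 1 = 4 ^ j * (3 * n + 1) := by
  induction j generalizing n with
  | zero => simp [scaleRad]
  | succ j ih => rw [scaleRad, ih, pow_succ]; ring

/-- `r_j(n) ≥ n`. [folklore] -/
theorem le_scaleRad (j n : ℕ) : n ≤ scaleRad j n := by
  have h := three_mul_scaleRad j n
  have h1 : 3 * n + 1 ≤ 4 ^ j * (3 * n + 1) := Nat.le_mul_of_pos_left _ (by positivity)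
  omega

/-- `r_j(n) < 4^j (n + 1)`. [folklore] -/
theorem scaleRad_lt (j n : ℕ) : scaleRad j n < 4 ^ j * (n + 1) := by
  have h := three_mul_scaleRad j n
  have : 3 * scaleRad j n < 3 * (4 ^ j * (n + 1)) := by
    have h4 : 0 < 4 ^ j := by positivity
    nlinarith
  omega

/-- `4^j ≤ r_j(n)` for `n ≥ 1`. [folklore] -/
theorem pow_le_scaleRad (j : ℕ) {n : ℕ} (hn : 1 ≤ n) : 4 ^ j ≤ scaleRad j n := by
  have h := three_mul_scaleRad j n
  have h4 : 0 < 4 ^ j := by positivity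
  nlinarith

/-- **Geometric decay over scales.** If `h` is harmonic on the finite set `S`, `h ≤ 1` on `∂S`,
`h = 0` on `∂S ∩ sqBox p R`, and every scale `n` with `4n ≤ R` has a blocked strip, then
`h ≤ θ^j` on `S ∩ sqBox p n₀` whenever `r_j(n₀) ≤ R` (`n₀ ≥ 1`). [folklore] -/
theorem le_scaleTheta_pow (hS : S.Finite) {h : Site 2 → ℝ} (hh : IsLatticeHarmonicOn h S)
    (h1 : ∀ w ∈ latticeOuterBoundary S, h w ≤ 1) {R : ℕ}
    (h0 : ∀ w ∈ latticeOuterBoundary S, w ∈ sqBox p R → h w = 0)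
    (hblk : ∀ n : ℕ, 1 ≤ n → 4 * n ≤ R → ¬ (HasLongCrossing S p 1 1 n (4 * n) ∧ HasLongCrossing S p 1 (-1) n (4 * n) ∧
        HasLongCrossing S p 0 1 n (4 * n) ∧ HasLongCrossing S p 0 (-1) n (4 * n))) :
    ∀ (j n₀ : ℕ), 1 ≤ n₀ → scaleRad j n₀ ≤ R → ∀ z ∈ S, z ∈ sqBox p n₀ → h z ≤ scaleTheta ^ j := by
  intro j
  induction j with
  | zero =>
    intro n₀ _ _ z hz _
    rw [pow_zero]
    exact hh.subharmonicOn.le_of_forall_boundary_le hS h1 z hz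
  | succ j ih =>
    intro n₀ hn₀ hR z hzS hz
    rw [scaleRad] at hR
    have h4 : 4 * n₀ + 1 ≤ R := le_trans (le_scaleRad j _) hR
    have ih' := ih (4 * n₀ + 1) (by omega) hR
    rw [pow_succ, mul_comm]
    refine scale_step hn₀ hh (fun w hw hwb => h0 w hw (sqBox_mono p (by exact_mod_cast h4) hwb))
      (hblk n₀ hn₀ (by omega)) (pow_nonneg scaleTheta_pos.le j) (fun w hwS hwb => ih' w hwS ?_) hzS hz
    have e : (((4 * n₀ + 1 : ℕ) : ℤ)) = 4 * (n₀ : ℤ) + 1 := by push_cast; ring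
    rw [e]; exact hwb

/-- The exponent of the weak Beurling estimate: `β = log(1/θ)/log 4 > 0`. [folklore] -/
def beurlingExp : ℝ := Real.log (1 / scaleTheta) / Real.log 4

/-- `β > 0`. [folklore] -/
theorem beurlingExp_pos : 0 < beurlingExp := by
  unfold beurlingExp
  refine div_pos (Real.log_pos ?_) (Real.log_pos (by norm_num))
  rw [lt_div_iff₀ scaleTheta_pos, one_mul]
  exact scaleTheta_lt_one

/-- The constant of the weak Beurling estimate: `C = 4^β/θ ≥ 1`. [folklore] -/
def beurlingConst : ℝ := (4 : ℝ) ^ beurlingExp / scaleTheta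

/-- `C ≥ 1`. [folklore] -/
theorem one_le_beurlingConst : 1 ≤ beurlingConst := by
  unfold beurlingConst
  rw [le_div_iff₀ scaleTheta_pos, one_mul]
  exact le_trans scaleTheta_lt_one.le (Real.one_le_rpow (by norm_num) beurlingExp_pos.le)

/-- `C > 0`. [folklore] -/
theorem beurlingConst_pos : 0 < beurlingConst := lt_of_lt_of_le one_pos one_le_beurlingConst

/-- **From scales to a power law**: `θ^j ≤ θ⁻¹ x^{-β}` whenever `0 < x < 4^{j+1}`. [folklore] -/
theorem scaleTheta_pow_le {j : ℕ} {x : ℝ} (hx : 0 < x) (hxj : x < (4 : ℝ) ^ (j + 1)) :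
    scaleTheta ^ j ≤ scaleTheta⁻¹ * x ^ (-beurlingExp) := by
  have hθ := scaleTheta_pos
  have hθ1 := scaleTheta_lt_one
  have hlogθ : Real.log scaleTheta < 0 := Real.log_neg hθ hθ1
  have hlog4 : 0 < Real.log 4 := Real.log_pos (by norm_num)
  -- `(j+1) log 4 > log x`
  have hj : Real.log x ≤ (j + 1) * Real.log 4 := by
    have := Real.log_lt_log hx hxj
    rw [Real.log_pow] at this
    push_cast at this
    exact this.le
  -- `θ^{j+1} ≤ x^{-β}`
  have key : scaleTheta ^ (j + 1) ≤ x ^ (-beurlingExp) := by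
    rw [Real.rpow_def_of_pos hx, ← Real.exp_log (pow_pos hθ (j + 1)), Real.exp_le_exp, Real.log_pow]
    unfold beurlingExp
    rw [one_div, Real.log_inv]
    have e : Real.log x * -(-Real.log scaleTheta / Real.log 4) = (Real.log x / Real.log 4) * Real.log scaleTheta := by
      field_simp
    rw [e]
    have hj' : Real.log x / Real.log 4 ≤ (j + 1 : ℝ) := by rw [div_le_iff₀ hlog4]; exact hj
    push_cast
    nlinarith
  calc scaleTheta ^ j = scaleTheta⁻¹ * scaleTheta ^ (j + 1) := by rw [pow_succ]; field_simp
    _ ≤ scaleTheta⁻¹ * x ^ (-beurlingExp) := by gcongr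

/-- **The estimate from blocked scales.** Under the hypotheses of `le_scaleTheta_pow`,
`h(z) ≤ C ((ρ+1)/(R+1))^β` on `S ∩ sqBox p ρ`. [folklore] -/
theorem le_beurlingConst_mul_rpow (hS : S.Finite) {h : Site 2 → ℝ} (hh : IsLatticeHarmonicOn h S)
    (h1 : ∀ w ∈ latticeOuterBoundary S, h w ≤ 1) {R : ℕ}
    (h0 : ∀ w ∈ latticeOuterBoundary S, w ∈ sqBox p R → h w = 0)
    (hblk : ∀ n : ℕ, 1 ≤ n → 4 * n ≤ R → ¬ (HasLongCrossing S p 1 1 n (4 * n) ∧ HasLongCrossing S p 1 (-1) n (4 * n) ∧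
        HasLongCrossing S p 0 1 n (4 * n) ∧ HasLongCrossing S p 0 (-1) n (4 * n)))
    {ρ : ℕ} {z : Site 2} (hzS : z ∈ S) (hz : z ∈ sqBox p ρ) :
    h z ≤ beurlingConst * (((ρ : ℝ) + 1) / ((R : ℝ) + 1)) ^ beurlingExp := by
  have hβ := beurlingExp_pos
  have hθ := scaleTheta_pos
  have hle1 : h z ≤ 1 := hh.subharmonicOn.le_of_forall_boundary_le hS h1 z hzS
  set n₀ := ρ + 1 with hn₀
  by_cases hRn : R < n₀
  · -- degenerate case: the bound is at least `1`
    have hbase : 1 ≤ ((ρ : ℝ) + 1) / ((R : ℝ) + 1) := by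
      rw [le_div_iff₀ (by positivity), one_mul]
      have : (R : ℝ) ≤ ρ := by exact_mod_cast (by omega : R ≤ ρ)
      linarith
    calc h z ≤ 1 := hle1
      _ ≤ beurlingConst * 1 := by rw [mul_one]; exact one_le_beurlingConst
      _ ≤ beurlingConst * (((ρ : ℝ) + 1) / ((R : ℝ) + 1)) ^ beurlingExp := by
          gcongr
          · exact beurlingConst_pos.le
          · exact Real.one_le_rpow hbase hβ.le
  · push Not at hRn
    -- the last scale that fits
    have hex : ∃ j : ℕ, R < scaleRad (j + 1) n₀ := ⟨R, lt_of_lt_of_le (Nat.lt_pow_self (by norm_num))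
      (le_trans (Nat.pow_le_pow_right (by norm_num) (Nat.le_succ R)) (pow_le_scaleRad (R + 1) (by omega)))⟩
    classical
    set j := Nat.find hex with hj
    have hj1 : R < scaleRad (j + 1) n₀ := Nat.find_spec hex
    have hj0 : scaleRad j n₀ ≤ R := by
      rcases Nat.eq_zero_or_pos j with h0' | hpos
      · rw [h0']; exact hRn
      · have := Nat.find_min hex (m := j - 1) (by omega)
        rw [not_lt, show j - 1 + 1 = j by omega] at this
        exact this
    have hdec := le_scaleTheta_pow hS hh h1 h0 hblk j n₀ (by omega) hj0 z hzS (sqBox_mono p (by simp [hn₀]) hz)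
    -- `R < r_{j+1}(n₀) < 4^{j+1} (n₀ + 1)`
    have hx : (R : ℝ) / ((n₀ : ℝ) + 1) < (4 : ℝ) ^ (j + 1) := by
      rw [div_lt_iff₀ (by positivity)]
      have := lt_trans hj1 (scaleRad_lt (j + 1) n₀)
      exact_mod_cast this
    have hRpos : (0 : ℝ) < R := by
      have : (1 : ℝ) ≤ n₀ := by exact_mod_cast (show 1 ≤ n₀ by omega)
      have : (n₀ : ℝ) ≤ R := by exact_mod_cast hRn
      linarith
    have hxpos : (0 : ℝ) < (R : ℝ) / ((n₀ : ℝ) + 1) := by positivity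
    have hpow := scaleTheta_pow_le hxpos hx
    -- `((n₀+1)/R)^β ≤ (4 (ρ+1)/(R+1))^β`
    have hcmp : ((R : ℝ) / ((n₀ : ℝ) + 1)) ^ (-beurlingExp) ≤ (4 : ℝ) ^ beurlingExp * (((ρ : ℝ) + 1) / ((R : ℝ) + 1)) ^ beurlingExp := by
      rw [Real.rpow_neg hxpos.le, ← Real.inv_rpow hxpos.le, inv_div, ← Real.mul_rpow (by norm_num) (by positivity)]
      refine Real.rpow_le_rpow (by positivity) ?_ hβ.le
      rw [div_le_iff₀ hRpos, hn₀]
      push_cast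
      rw [show (4 : ℝ) * ((ρ + 1) / (R + 1)) * R = (4 * (ρ + 1)) * (R / (R + 1)) by ring]
      have hR1 : (1 : ℝ) ≤ R := by
        have : (1 : ℝ) ≤ n₀ := by exact_mod_cast (show 1 ≤ n₀ by omega)
        have : (n₀ : ℝ) ≤ R := by exact_mod_cast hRn
        linarith
      have hfrac : 1 / 2 ≤ (R : ℝ) / (R + 1) := by
        rw [le_div_iff₀ (by positivity)]; linarith
      have hρ : (0 : ℝ) ≤ ρ := by positivity
      nlinarith
    calc h z ≤ scaleTheta ^ j := hdec
      _ ≤ scaleTheta⁻¹ * ((R : ℝ) / ((n₀ : ℝ) + 1)) ^ (-beurlingExp) := hpow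
      _ ≤ scaleTheta⁻¹ * ((4 : ℝ) ^ beurlingExp * (((ρ : ℝ) + 1) / ((R : ℝ) + 1)) ^ beurlingExp) := by gcongr
      _ = beurlingConst * (((ρ : ℝ) + 1) / ((R : ℝ) + 1)) ^ beurlingExp := by
          unfold beurlingConst; ring

end WeakBeurling

/-! ### §6. The weak Beurling estimate -/

open WeakBeurling

/-- **The weak discrete Beurling estimate, cut form** (Kesten 1987; Smirnov 2010, Appendix B,
Lemma B.2, the "weaker version of discrete Beurling's estimate with `ε(δ/r)`" used in the proof of
Lemma B.3 — here with the power law `ε(t) = C t^β`). Let `h` be lattice harmonic on a finite set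
`S ⊆ ℤ²`, at most `1` on the outer vertex boundary `∂S`, and equal to `0` at the points of `∂S`
in the box `sqBox p R` of sup-radius `R` about a site `p`; assume that `p` is joined to a point
outside `sqBox p R` by a nearest-neighbour path of `ℤ²` avoiding `S` (for the lattice
approximation of a simply connected domain: `p` is a boundary site and the path runs through the
exterior). Then `h(z) ≤ C ((ρ + 1)/(R + 1))^β` at every `z ∈ S` within sup-distance `ρ` of `p`,
with universal constants `C = WeakBeurling.beurlingConst`, `β = WeakBeurling.beurlingExp > 0`.
In random-walk terms: the walk from `z` hits `∂S` before leaving `sqBox p R` with probability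
`≥ 1 - C (ρ/R)^β`. Proof: at each `4`-adic scale the cut blocks a long crossing of one of the four
strips of the square annulus (planar crossing lemma and winding numbers, `PlanarDuality.lean`),
whence the escape function of the scale is `≥ c_b²` near the centre by two barrier steps with the
first sine mode of a lattice rectangle (`BoxSineHarmonic.lean`) and the comparison principle
(`LatticeLaplacian.lean`); the scales multiply. [cite: Smirnov2010, Appendix B, Lemma B.2] -/
theorem weakBeurling_of_cutPath {S : Set (Site 2)} (hS : S.Finite) {h : Site 2 → ℝ} (hh : IsLatticeHarmonicOn h S)
    (h1 : ∀ w ∈ latticeOuterBoundary S, h w ≤ 1) {p : Site 2} {R : ℕ}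
    (h0 : ∀ w ∈ latticeOuterBoundary S, w ∈ sqBox p R → h w = 0)
    {d : Site 2} (q : (zdGraph 2).Walk p d) (hd : d ∉ sqBox p R) (hq : ∀ z ∈ q.support, z ∉ S)
    {ρ : ℕ} {z : Site 2} (hzS : z ∈ S) (hz : z ∈ sqBox p ρ) :
    h z ≤ beurlingConst * (((ρ : ℝ) + 1) / ((R : ℝ) + 1)) ^ beurlingExp := by
  refine le_beurlingConst_mul_rpow hS hh h1 h0 (fun n hn h4 => ?_) hzS hz
  exact not_all_longCrossings_of_cut (by exact_mod_cast hn) (by omega) q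
    (fun h' => hd (sqBox_mono p (by exact_mod_cast h4) h')) hq

/-- **The weak discrete Beurling estimate, circuit form.** Same conclusion when, instead of a cut,
no closed lattice walk inside `S ∩ sqBox p R` winds around `p`
(`Literature.Probability.Percolation.walkWinding W p = 0` for all of them) — the form obtained
from an exterior path on a finer lattice by `walkWinding_closed_eq_of_walk`. [cite: Smirnov2010, Appendix B, Lemma B.2] -/
theorem weakBeurling_of_noCircuit {S : Set (Site 2)} (hS : S.Finite) {h : Site 2 → ℝ} (hh : IsLatticeHarmonicOn h S)
    (h1 : ∀ w ∈ latticeOuterBoundary S, h w ≤ 1) {p : Site 2} {R : ℕ}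
    (h0 : ∀ w ∈ latticeOuterBoundary S, w ∈ sqBox p R → h w = 0)
    (hW : ∀ (c : Site 2) (W : (zdGraph 2).Walk c c), (∀ z ∈ W.support, z ∈ S ∧ z ∈ sqBox p R) → walkWinding W p = 0)
    {ρ : ℕ} {z : Site 2} (hzS : z ∈ S) (hz : z ∈ sqBox p ρ) :
    h z ≤ beurlingConst * (((ρ : ℝ) + 1) / ((R : ℝ) + 1)) ^ beurlingExp := by
  refine le_beurlingConst_mul_rpow hS hh h1 h0 (fun n hn h4 => ?_) hzS hz
  rintro ⟨hT, hB, hR, hL⟩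
  obtain ⟨c, W, hW', hwind⟩ := exists_circuit_of_longCrossings (by exact_mod_cast hn) (by omega) hT hB hR hL
  have h := hW c W fun z hz => ⟨(hW' z hz).1, sqBox_mono p (by exact_mod_cast h4) (hW' z hz).2.1⟩
  rw [hwind] at h
  norm_num at h

/-- **The weak discrete Beurling estimate** (Kesten 1987; Smirnov 2010, Appendix B, Lemma B.2)
with universal constants: there are `C, β > 0` such that for every finite `S ⊆ ℤ²`, every `h`
lattice harmonic on `S` with `h ≤ 1` on `∂S` and `h = 0` on `∂S ∩ sqBox p R`, and every site `p`
joined to the outside of `sqBox p R` by a lattice path avoiding `S`,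
`h ≤ C ((ρ+1)/(R+1))^β` on `S ∩ sqBox p ρ`. [cite: Smirnov2010, Appendix B, Lemma B.2] -/
theorem weakBeurling :
    ∃ C β : ℝ, 0 < C ∧ 0 < β ∧ ∀ (S : Set (Site 2)), S.Finite → ∀ (h : Site 2 → ℝ), IsLatticeHarmonicOn h S →
      (∀ w ∈ latticeOuterBoundary S, h w ≤ 1) → ∀ (p : Site 2) (R : ℕ),
      (∀ w ∈ latticeOuterBoundary S, w ∈ sqBox p R → h w = 0) →
      (∃ (d : Site 2) (q : (zdGraph 2).Walk p d), d ∉ sqBox p R ∧ ∀ z ∈ q.support, z ∉ S) →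
      ∀ (ρ : ℕ), ∀ z ∈ S, z ∈ sqBox p ρ → h z ≤ C * (((ρ : ℝ) + 1) / ((R : ℝ) + 1)) ^ β :=
  ⟨beurlingConst, beurlingExp, beurlingConst_pos, beurlingExp_pos,
    fun _ hS _ hh h1 _ _ h0 ⟨_, q, hd, hq⟩ _ _ hzS hz => weakBeurling_of_cutPath hS hh h1 h0 q hd hq hzS hz⟩

end Literature.Probability.LatticeModels
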